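import Literature.MathematicalPhysics.QuantumFieldTheory.Balaban1983to89.B6Ineq243HolderDualTwoLevelBox
import Literature.MathematicalPhysics.QuantumFieldTheory.Balaban1983to89.B6Prop22AdjTwoLevelBox

/-!
# `Balaban1983to89.B6Prop22DualHolderTwoLevelBox` — [B6] Proposition 2.2 (2.67), FIFTH ENTRY `‖ζG′∇*λ‖_α`, for the
genuine two-level operator `Δ_Ω^{L^{−j},N} + m² + Q′*aQ′` on a box of `L`-blocks: the Hölder quotient in `x` of the kernel
of `G′∇*` along the printed route «(2.66) ⇒ (2.67)» in the transposed ordering `G′ = G′₀ + RᵀG′`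
(file 14 of the two-level parametrix; nothing existing is touched; no fact is minted)

FRAMING (verbatim cell line):
statement-level skeleton of published theorems with citation tags; proofs where landed; nothing here is a claim about the Yang–Mills mass gap

Source under audit (cell pub-balaban): T. Bałaban, *Propagators and renormalization transformations for lattice gauge
theories. II*, Commun. Math. Phys. **96** (1984) 223–250 [`Balaban1984PropagatorsII`, "B6"], p. 234 [PDF 12] Proposition
2.2 (2.67), fifth entry `‖ζ(∇G′)λ‖_α, ‖ζ(G′∇*)λ‖_α ≤ O(1)(L^jη)^{1−α}(‖ζ‖_α + |ζ|)e^{−δ₁dist(supp ζ,supp λ)}|λ|`, and «The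
similar inequalities hold for a derivative of G′λ and for a Hölder norm of a derivative»; p. 230 [PDF 8] (2.40), (2.44);
p. 232 [PDF 10] (2.49)–(2.51); gap record HOME/GAPS.md G-B6-21 (the [3]-level input, `B4Thm19ZeroBoxHolderDual`).

## WHAT THIS FILE CERTIFIES (kernel-checked; `A = 0`)

§1 the weighted `ℓ¹` of `K(h)u` against an ARBITRARY admissible weight `e` (`e ≥ 0`, `e(z) ≤ e^{δ|w−z|/n}e(w)`):
`sumE_kComm_le` — the three terms of (2.40) summed against `e` (`B6Prop22AdjTwoLevelBox.wsum_kComm_le` is the case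
`e = e^{δ|x−·|/n}`; here also the two-centre weight `e^{δmin(|x−·|,|x′−·|)/n}` of the Hölder functionals, `wsum2_kComm_le`).
§2 the two-row vector of a cut cube `u = W(h(a′)Ĝ(a′,·) − h(a)Ĝ(a,·))` (`W = (n/|a′−a|)^α`, `|a′−a| < n`): its weighted
two-centre size and that of its bond differences are bounded by the cube inputs ((2.43) rows, `G′(□)∂^*` rows, the
column Hölder clause `B6Ineq243HolderDualTwoLevelBox`, the long row difference) — `cube_pair_wsum2_le`,
`cube_pair_diff_wsum2_le`.
§3 the Hölder-weighted long COLUMN differences of `R` are `O(M^{−1})` in the two-centre form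
(`wsum2_transpose_bPad_pair_le`, `wsum2_transpose_rOp_pair_le`: `Σ_y W|R(y,x′) − R(y,x)|e ≤ C_Ψ/(LM_h)`).
§4 the (2.64)-input for the row pairs of `dstar G′₀` (`wsum2_dstar_aTerm_pair_le`, `wsum2_dstar_gZero_pair_le`).
§5 **`prop22_entry5_twoLevelBox`**: the fifth entry of (2.67) for the genuine two-level box operator, from the transposed
fixed point `dstar G′ = dstar G′₀ + Rᵀ·dstar G′` — no iteration is needed: the long row difference falls on `Rᵀ` (§3) and the
rows of `dstar G′` are the third entry (`B6Prop22AdjTwoLevelBox.prop22_entry3_twoLevelBox`); printed pairing form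
`gTwoLevel_dstar_holder_value_decay`.  With this file all six entries of (2.67) are certified for the two-level box operator.

Value = kernel certificate of the fifth entry of (2.67) at `A = 0` for the two-level box operator; NOT summit progress
(the Yang–Mills statements are untouched).
-/

namespace Literature.MathematicalPhysics.QuantumFieldTheory.Balaban1983to89.B6Prop22DualHolderTwoLevelBox

open Finset Matrix
open Literature.MathematicalPhysics.QuantumFieldTheory.Balaban1983to89.B4Reflection242 (boxDom mem_boxDom)
open Literature.MathematicalPhysics.QuantumFieldTheory.Balaban1983to89.B4ContourShift (supNorm supNorm_nonneg)
open Literature.MathematicalPhysics.QuantumFieldTheory.Balaban1983to89.B4Lemma22ReduceZero (Box)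
open Literature.MathematicalPhysics.QuantumFieldTheory.Balaban1983to89.B4Thm110ZeroBox (roww roww_nonneg
  supNorm_sub_le_sub_add_sub)
open Literature.MathematicalPhysics.QuantumFieldTheory.Balaban1983to89.B4Thm110ZeroBoxDeriv (wsum wsum_nonneg
  wsum_add_le wsum_mul_left wsum_row)
open Literature.MathematicalPhysics.QuantumFieldTheory.Balaban1983to89.B4Thm19ZeroBoxHolder (wsum2 wsum2_nonneg
  wsum2_add_le wsum2_mul_left wsum2_le_wsum_left wsum2_le_wsum_right wsum2_split_le wsum2_mono_rate)
open Literature.MathematicalPhysics.QuantumFieldTheory.Balaban1983to89.B4Lemma22ZeroBoxDerivDual (fwd fwd_spec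
  fwd_eq_of_nbr)
open Literature.MathematicalPhysics.QuantumFieldTheory.Balaban1983to89.B4Green242Bridge (boxNbrs)
open Literature.MathematicalPhysics.QuantumFieldTheory.Balaban1983to89.B6Ineq243TwoLevelBox
open Literature.MathematicalPhysics.QuantumFieldTheory.Balaban1983to89.B6Ineq243AdjTwoLevelBox (dstar dstar_apply
  roww_dstar)
open Literature.MathematicalPhysics.QuantumFieldTheory.Balaban1983to89.B6Prop22AdjTwoLevelBox (vEntry_comm
  sum_ite_eq_add_single sum_boxNbrs_le' supNorm_fwd_sub_le)
open Literature.MathematicalPhysics.QuantumFieldTheory.Balaban1983to89.B6Ineq243HolderDualTwoLevelBox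
  (wsum2_longRow_holder_le)
open B4StripSumsHolder (one_le_supNorm)

noncomputable section

variable {d : ℕ}

/-! ## §1 The weighted `ℓ¹` of `K(h)u` against an admissible weight (the transposed (2.44), abstract-weight form) -/

section KCommWeight

variable {N : Fin (d + 1) → ℕ}

/-- an ADMISSIBLE WEIGHT moves by at most `e^{δ}` along a bond. [folklore] -/
private theorem weight_fwd_le {δ : ℝ} (hδ : 0 ≤ δ) {n : ℕ} (hn : 1 ≤ n) (e : ↥(boxDom N) → ℝ)
    (hew : ∀ w z : ↥(boxDom N), e z ≤ Real.exp (δ * supNorm (w.1 - z.1) / n) * e w)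
    (he0 : ∀ z, 0 ≤ e z) (μ : Fin (d + 1)) (w : ↥(boxDom N)) : e (fwd N μ w) ≤ Real.exp δ * e w := by
  have hn' : (1 : ℝ) ≤ n := by exact_mod_cast hn
  refine (hew w (fwd N μ w)).trans (mul_le_mul_of_nonneg_right (Real.exp_le_exp.2 ?_) (he0 w))
  have h1 : supNorm (w.1 - (fwd N μ w).1) ≤ 1 := by
    rw [← B4TorusKernel.supNorm_neg, neg_sub]; exact supNorm_fwd_sub_le μ w
  calc δ * supNorm (w.1 - (fwd N μ w).1) / n ≤ δ * 1 / n :=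
        div_le_div_of_nonneg_right (mul_le_mul_of_nonneg_left h1 hδ) (by positivity)
    _ ≤ δ := by rw [mul_one]; exact div_le_self hδ hn'

/-- **THE BOND RESUMMATION AGAINST AN ADMISSIBLE WEIGHT** (`B6Prop22AdjTwoLevelBox.weighted_star_absDiff_le` with the
weight abstracted): `Σ_z e(z)Σ_{w∼z}|ξ^{−1}(u(w) − u(z))| ≤ (1+e^{δ})Σ_μΣ_z|ξ^{−1}(u(fwd_μz) − u(z))|e(z)`.
[cite: Balaban1984PropagatorsII, (2.40) p.230, bookkeeping] -/
theorem sumE_star_absDiff_le {δ : ℝ} (hδ : 0 ≤ δ) {n : ℕ} (hn : 1 ≤ n) (e : ↥(boxDom N) → ℝ)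
    (he0 : ∀ z, 0 ≤ e z) (hew : ∀ w z : ↥(boxDom N), e z ≤ Real.exp (δ * supNorm (w.1 - z.1) / n) * e w)
    (u : ↥(boxDom N) → ℝ) :
    ∑ z, e z * ∑ w ∈ boxNbrs N z, |(n : ℝ) * (u w - u z)|
      ≤ (1 + Real.exp δ) * ∑ μ, ∑ z, |(n : ℝ) * (u (fwd N μ z) - u z)| * e z := by
  have hefwd : ∀ (μ : Fin (d + 1)) (w : ↥(boxDom N)), e (fwd N μ w) ≤ Real.exp δ * e w :=
    weight_fwd_le hδ hn e hew he0
  have hstar : ∀ z, e z * ∑ w ∈ boxNbrs N z, |(n : ℝ) * (u w - u z)|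
      ≤ ∑ μ : Fin (d + 1), (e z * (∑ w : ↥(boxDom N), if w.1 = z.1 + Pi.single μ 1 then |(n : ℝ) * (u w - u z)| else 0)
          + e z * (∑ w : ↥(boxDom N), if z.1 = w.1 + Pi.single μ 1 then |(n : ℝ) * (u w - u z)| else 0)) := by
    intro z
    have := mul_le_mul_of_nonneg_left (sum_boxNbrs_le' z (fun w => |(n : ℝ) * (u w - u z)|) fun w => abs_nonneg _)
      (he0 z)
    refine this.trans (le_of_eq ?_)
    rw [Finset.mul_sum]
    exact Finset.sum_congr rfl fun μ _ => mul_add _ _ _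
  refine (Finset.sum_le_sum fun z _ => hstar z).trans ?_
  rw [Finset.sum_comm, Finset.mul_sum]
  refine Finset.sum_le_sum fun μ _ => ?_
  rw [Finset.sum_add_distrib]
  have hF : ∑ z, e z * (∑ w : ↥(boxDom N), if w.1 = z.1 + Pi.single μ 1 then |(n : ℝ) * (u w - u z)| else 0)
      ≤ ∑ z, |(n : ℝ) * (u (fwd N μ z) - u z)| * e z := by
    refine Finset.sum_le_sum fun z _ => ?_
    rw [sum_ite_eq_add_single μ z (fun w => |(n : ℝ) * (u w - u z)|), mul_comm]
    refine mul_le_mul_of_nonneg_right ?_ (he0 z)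
    split_ifs
    · exact le_rfl
    · exact abs_nonneg _
  have hB : ∑ z, e z * (∑ w : ↥(boxDom N), if z.1 = w.1 + Pi.single μ 1 then |(n : ℝ) * (u w - u z)| else 0)
      ≤ Real.exp δ * ∑ z, |(n : ℝ) * (u (fwd N μ z) - u z)| * e z := by
    calc ∑ z, e z * (∑ w : ↥(boxDom N), if z.1 = w.1 + Pi.single μ 1 then |(n : ℝ) * (u w - u z)| else 0)
        = ∑ w : ↥(boxDom N), ∑ z : ↥(boxDom N),
            (if z.1 = w.1 + Pi.single μ 1 then e z * |(n : ℝ) * (u w - u z)| else 0) := by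
          rw [Finset.sum_comm]
          refine Finset.sum_congr rfl fun z _ => ?_
          rw [Finset.mul_sum]
          exact Finset.sum_congr rfl fun w _ => by split_ifs <;> simp
      _ = ∑ w : ↥(boxDom N), (if w.1 + Pi.single μ 1 ∈ boxDom N then
            e (fwd N μ w) * |(n : ℝ) * (u w - u (fwd N μ w))| else 0) :=
          Finset.sum_congr rfl fun w _ => sum_ite_eq_add_single μ w (fun z => e z * |(n : ℝ) * (u w - u z)|)
      _ ≤ ∑ w : ↥(boxDom N), Real.exp δ * (|(n : ℝ) * (u (fwd N μ w) - u w)| * e w) := by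
          refine Finset.sum_le_sum fun w _ => ?_
          split_ifs
          · rw [show (n : ℝ) * (u w - u (fwd N μ w)) = -((n : ℝ) * (u (fwd N μ w) - u w)) by ring, abs_neg,
              mul_comm, mul_left_comm]
            exact mul_le_mul_of_nonneg_left (hefwd μ w) (abs_nonneg _)
          · exact mul_nonneg (Real.exp_pos _).le (mul_nonneg (abs_nonneg _) (he0 w))
      _ = Real.exp δ * ∑ z, |(n : ℝ) * (u (fwd N μ z) - u z)| * e z := by rw [Finset.mul_sum]
  have h0 : 0 ≤ ∑ z, |(n : ℝ) * (u (fwd N μ z) - u z)| * e z :=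
    Finset.sum_nonneg fun z _ => mul_nonneg (abs_nonneg _) (he0 z)
  linarith [hF, hB]

/-- **THE WEIGHTED `ℓ¹` OF `K(h)u` AGAINST AN ADMISSIBLE WEIGHT** (the transposed (2.44), abstract-weight form of
`B6Prop22AdjTwoLevelBox.wsum_kComm_le`): for the genuine two-level operator `E` (`Λ` a union of `L`-blocks), a cut-off `h`
with unit-scale Lipschitz constant `κ₁` and Laplacian bound `κ₂`, every `u` and every weight `e ≥ 0` with
`e(z) ≤ e^{δ|w−z|/n}e(w)`:
`Σ_z|(K(h)u)(z)|e(z) ≤ κ₁(1+e^{δ})Σ_μΣ_z|∂^ξ_μu(z)|e(z) + (κ₂ + (a_j+a)Le^{δL}κ₁)Σ_z|u(z)|e(z)`.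
[cite: Balaban1984PropagatorsII, (2.40), (2.44) p.230] -/
theorem sumE_kComm_le {n ℓ : ℕ} (hn : 1 ≤ n) {aj a m2 : ℝ} (haj : 0 < aj) (ha : 0 ≤ a)
    {M' : Fin (d + 1) → ℕ} {Λ : Finset ↥(boxDom (fun i => (ℓ + 1) * M' i))} (hΛ : IsBlockUnion ℓ M' Λ)
    {δ κ₁ κ₂ : ℝ} (hδ : 0 ≤ δ) (hκ₁ : 0 ≤ κ₁)
    (h : ↥(boxDom (fun i => n * ((ℓ + 1) * M' i))) → ℝ)
    (hLip : ∀ z z' : ↥(boxDom (fun i => n * ((ℓ + 1) * M' i))), |h z' - h z| ≤ κ₁ * supNorm (z'.1 - z.1) / n)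
    (hLap : ∀ z : ↥(boxDom (fun i => n * ((ℓ + 1) * M' i))),
      |(n : ℝ) ^ 2 * ∑ z' ∈ boxNbrs _ z, (h z' - h z)| ≤ κ₂)
    (u : ↥(boxDom (fun i => n * ((ℓ + 1) * M' i))) → ℝ)
    (e : ↥(boxDom (fun i => n * ((ℓ + 1) * M' i))) → ℝ) (he0 : ∀ z, 0 ≤ e z)
    (hew : ∀ w z : ↥(boxDom (fun i => n * ((ℓ + 1) * M' i))), e z ≤ Real.exp (δ * supNorm (w.1 - z.1) / n) * e w) :
    ∑ z, |(kComm (twoLevelOp n ℓ aj a m2 M' Λ) h *ᵥ u) z| * e z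
      ≤ κ₁ * (1 + Real.exp δ) * ∑ μ, ∑ z, |(n : ℝ) * (u (fwd _ μ z) - u z)| * e z
        + (κ₂ + (aj + a) * ((ℓ : ℝ) + 1) * Real.exp (δ * ((ℓ : ℝ) + 1)) * κ₁) * ∑ z, |u z| * e z := by
  have hn' : (0 : ℝ) < n := by exact_mod_cast hn
  have hn1 : (1 : ℝ) ≤ n := by exact_mod_cast hn
  have hL0 : (0 : ℝ) ≤ (ℓ : ℝ) + 1 := by positivity
  -- (2.40) at every point, in absolute value
  have hpt : ∀ z, |(kComm (twoLevelOp n ℓ aj a m2 M' Λ) h *ᵥ u) z|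
      ≤ κ₁ * ∑ w ∈ boxNbrs _ z, |(n : ℝ) * (u w - u z)| + κ₂ * |u z|
        + κ₁ * ((ℓ : ℝ) + 1) * ∑ w, vEntry hn ℓ aj a Λ z w * |u w| := by
    intro z
    rw [eq240_twoLevel hn aj a m2 hΛ h u z]
    refine (abs_add_le _ _).trans (add_le_add ((abs_add_le _ _).trans (add_le_add ?_ ?_)) ?_)
    · refine (Finset.abs_sum_le_sum_abs _ _).trans ?_
      rw [Finset.mul_sum]
      refine Finset.sum_le_sum fun w hw => ?_
      rw [abs_mul]
      refine mul_le_mul_of_nonneg_right ?_ (abs_nonneg _)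
      rw [abs_mul, abs_of_nonneg hn'.le]
      have h1 := hLip z w
      have h2 := supNorm_sub_le_one_of_mem_boxNbrs hw
      calc (n : ℝ) * |h w - h z| ≤ (n : ℝ) * (κ₁ * supNorm (w.1 - z.1) / n) := mul_le_mul_of_nonneg_left h1 hn'.le
        _ = κ₁ * supNorm (w.1 - z.1) := by field_simp
        _ ≤ κ₁ * 1 := mul_le_mul_of_nonneg_left h2 hκ₁
        _ = κ₁ := mul_one _
    · rw [abs_mul, mul_comm]
      exact mul_le_mul_of_nonneg_right (hLap z) (abs_nonneg _)
    · refine (Finset.abs_sum_le_sum_abs _ _).trans ?_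
      rw [Finset.mul_sum]
      refine Finset.sum_le_sum fun w _ => ?_
      have hv0 := vEntry_nonneg hn ℓ haj ha Λ z w
      rw [abs_mul, abs_mul, abs_of_nonneg hv0]
      by_cases hv : vEntry hn ℓ aj a Λ z w = 0
      · rw [hv]; simp
      · have hd := supNorm_le_of_vEntry_ne_zero hn ℓ aj a Λ hv
        have h1 := hLip w z
        have hh : |h z - h w| ≤ κ₁ * ((ℓ : ℝ) + 1) := by
          calc |h z - h w| ≤ κ₁ * supNorm (z.1 - w.1) / n := h1
            _ ≤ κ₁ * ((n : ℝ) * ((ℓ : ℝ) + 1)) / n :=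
                div_le_div_of_nonneg_right (mul_le_mul_of_nonneg_left hd hκ₁) hn'.le
            _ = κ₁ * ((ℓ : ℝ) + 1) := by field_simp
        calc vEntry hn ℓ aj a Λ z w * |h z - h w| * |u w|
            ≤ vEntry hn ℓ aj a Λ z w * (κ₁ * ((ℓ : ℝ) + 1)) * |u w| :=
              mul_le_mul_of_nonneg_right (mul_le_mul_of_nonneg_left hh hv0) (abs_nonneg _)
          _ = κ₁ * ((ℓ : ℝ) + 1) * (vEntry hn ℓ aj a Λ z w * |u w|) := by ring
  -- the column sums of the averaging part against the weight
  have hcol : ∀ w, ∑ z, vEntry hn ℓ aj a Λ z w * e z ≤ (aj + a) * Real.exp (δ * ((ℓ : ℝ) + 1)) * e w := by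
    intro w
    have hz : ∀ z, vEntry hn ℓ aj a Λ z w * e z ≤ vEntry hn ℓ aj a Λ w z * (Real.exp (δ * ((ℓ : ℝ) + 1)) * e w) := by
      intro z
      rw [vEntry_comm hn aj a hΛ z w]
      by_cases hv : vEntry hn ℓ aj a Λ w z = 0
      · rw [hv, zero_mul, zero_mul]
      · refine mul_le_mul_of_nonneg_left ?_ (vEntry_nonneg hn ℓ haj ha Λ w z)
        have hd := supNorm_le_of_vEntry_ne_zero hn ℓ aj a Λ hv
        refine (hew w z).trans (mul_le_mul_of_nonneg_right (Real.exp_le_exp.2 ?_) (he0 w))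
        calc δ * supNorm (w.1 - z.1) / n ≤ δ * ((n : ℝ) * ((ℓ : ℝ) + 1)) / n :=
              div_le_div_of_nonneg_right (mul_le_mul_of_nonneg_left hd hδ) hn'.le
          _ = δ * ((ℓ : ℝ) + 1) := by field_simp
    refine (Finset.sum_le_sum fun z _ => hz z).trans ?_
    rw [← Finset.sum_mul, mul_assoc (aj + a)]
    exact mul_le_mul_of_nonneg_right (sum_vEntry_le hn haj ha Λ w) (mul_nonneg (Real.exp_pos _).le (he0 w))
  -- summing (2.40) against the weight
  have hsum : ∑ z, |(kComm (twoLevelOp n ℓ aj a m2 M' Λ) h *ᵥ u) z| * e z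
      ≤ κ₁ * ∑ z, e z * ∑ w ∈ boxNbrs _ z, |(n : ℝ) * (u w - u z)| + κ₂ * ∑ z, |u z| * e z
        + κ₁ * ((ℓ : ℝ) + 1) * ∑ z, e z * ∑ w, vEntry hn ℓ aj a Λ z w * |u w| := by
    rw [Finset.mul_sum, Finset.mul_sum, Finset.mul_sum, ← Finset.sum_add_distrib, ← Finset.sum_add_distrib]
    refine Finset.sum_le_sum fun z _ => ?_
    have := mul_le_mul_of_nonneg_right (hpt z) (he0 z)
    refine this.trans (le_of_eq ?_)
    ring
  refine hsum.trans ?_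
  have h1 := mul_le_mul_of_nonneg_left (sumE_star_absDiff_le hδ hn e he0 hew u) hκ₁
  have h3 : ∑ z, e z * ∑ w, vEntry hn ℓ aj a Λ z w * |u w|
      ≤ (aj + a) * Real.exp (δ * ((ℓ : ℝ) + 1)) * ∑ z, |u z| * e z := by
    calc ∑ z, e z * ∑ w, vEntry hn ℓ aj a Λ z w * |u w|
        = ∑ w, |u w| * ∑ z, vEntry hn ℓ aj a Λ z w * e z := by
          simp_rw [Finset.mul_sum]
          rw [Finset.sum_comm]
          exact Finset.sum_congr rfl fun w _ => Finset.sum_congr rfl fun z _ => by ring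
      _ ≤ ∑ w, |u w| * ((aj + a) * Real.exp (δ * ((ℓ : ℝ) + 1)) * e w) :=
          Finset.sum_le_sum fun w _ => mul_le_mul_of_nonneg_left (hcol w) (abs_nonneg _)
      _ = (aj + a) * Real.exp (δ * ((ℓ : ℝ) + 1)) * ∑ z, |u z| * e z := by
          rw [Finset.mul_sum]
          exact Finset.sum_congr rfl fun w _ => by ring
  have h3' := mul_le_mul_of_nonneg_left h3 (mul_nonneg hκ₁ hL0)
  have hU0 : 0 ≤ ∑ z, |u z| * e z := Finset.sum_nonneg fun z _ => mul_nonneg (abs_nonneg _) (he0 z)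
  nlinarith [h1, h3', hU0]

/-- the TWO-CENTRE weight `e^{δmin(|x−z|,|x′−z|)/n}` is admissible (`dist({x,x′},z) ≤ dist({x,x′},w) + |w−z|`).
[cite: Balaban1984PropagatorsII, (2.67) p.234 («dist(supp ζ, supp λ)»), bookkeeping] -/
theorem twoCentre_weight_admissible {δ : ℝ} (hδ : 0 ≤ δ) (n : ℕ) (x x' w z : ↥(boxDom N)) :
    Real.exp (δ * min (supNorm (x.1 - z.1)) (supNorm (x'.1 - z.1)) / n)
      ≤ Real.exp (δ * supNorm (w.1 - z.1) / n) * Real.exp (δ * min (supNorm (x.1 - w.1)) (supNorm (x'.1 - w.1)) / n) := by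
  rw [← Real.exp_add]
  apply Real.exp_le_exp.2
  rw [← add_div, ← mul_add]
  refine div_le_div_of_nonneg_right (mul_le_mul_of_nonneg_left ?_ hδ) (Nat.cast_nonneg n)
  have h1 := supNorm_sub_le_sub_add_sub x.1 w.1 z.1
  have h2 := supNorm_sub_le_sub_add_sub x'.1 w.1 z.1
  rcases le_total (supNorm (x.1 - w.1)) (supNorm (x'.1 - w.1)) with h | h
  · rw [min_eq_left h]
    exact (min_le_left _ _).trans (by linarith)
  · rw [min_eq_right h]
    exact (min_le_right _ _).trans (by linarith)

/-- **THE TWO-CENTRE WEIGHTED `ℓ¹` OF `K(h)u`**: `sumE_kComm_le` for the weight of the Hölder functionals.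
[cite: Balaban1984PropagatorsII, (2.40), (2.44) p.230, (2.67) p.234] -/
theorem wsum2_kComm_le {n ℓ : ℕ} (hn : 1 ≤ n) {aj a m2 : ℝ} (haj : 0 < aj) (ha : 0 ≤ a)
    {M' : Fin (d + 1) → ℕ} {Λ : Finset ↥(boxDom (fun i => (ℓ + 1) * M' i))} (hΛ : IsBlockUnion ℓ M' Λ)
    {δ κ₁ κ₂ : ℝ} (hδ : 0 ≤ δ) (hκ₁ : 0 ≤ κ₁)
    (h : ↥(boxDom (fun i => n * ((ℓ + 1) * M' i))) → ℝ)
    (hLip : ∀ z z' : ↥(boxDom (fun i => n * ((ℓ + 1) * M' i))), |h z' - h z| ≤ κ₁ * supNorm (z'.1 - z.1) / n)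
    (hLap : ∀ z : ↥(boxDom (fun i => n * ((ℓ + 1) * M' i))),
      |(n : ℝ) ^ 2 * ∑ z' ∈ boxNbrs _ z, (h z' - h z)| ≤ κ₂)
    (u : ↥(boxDom (fun i => n * ((ℓ + 1) * M' i))) → ℝ) (x x' : ↥(boxDom (fun i => n * ((ℓ + 1) * M' i)))) :
    wsum2 δ n x x' (fun z => (kComm (twoLevelOp n ℓ aj a m2 M' Λ) h *ᵥ u) z)
      ≤ κ₁ * (1 + Real.exp δ) * ∑ μ, wsum2 δ n x x' (fun z => (n : ℝ) * (u (fwd _ μ z) - u z))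
        + (κ₂ + (aj + a) * ((ℓ : ℝ) + 1) * Real.exp (δ * ((ℓ : ℝ) + 1)) * κ₁) * wsum2 δ n x x' u := by
  unfold wsum2
  exact sumE_kComm_le hn haj ha hΛ hδ hκ₁ h hLip hLap u _ (fun z => (Real.exp_pos _).le)
    (fun w z => twoCentre_weight_admissible hδ n x x' w z)

end KCommWeight

/-! ## §2 The two-row vector of a cut cube: `u = W·(t′Ĝ(a′,·) − tĜ(a,·))` -/

section CubePair

variable {N : Fin (d + 1) → ℕ}

/-- the Hölder weight times the long step is at most the mesh: `(n/s)^α·s ≤ n` for `1 ≤ s ≤ n`, `α ≤ 1`.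
[cite: Balaban1984PropagatorsII, (2.67) p.234 (the factor `(L^jη)^{1−α}`), bookkeeping] -/
theorem holderWeight_mul_le {n : ℕ} {s α : ℝ} (hs1 : 1 ≤ s) (hsn : s ≤ n) (hα1 : α ≤ 1) :
    ((n : ℝ) / s) ^ α * s ≤ n := by
  have hs0 : 0 < s := lt_of_lt_of_le one_pos hs1
  have h1 : 1 ≤ (n : ℝ) / s := by rw [le_div_iff₀ hs0, one_mul]; exact hsn
  have h2 : ((n : ℝ) / s) ^ α ≤ (n : ℝ) / s := by
    calc ((n : ℝ) / s) ^ α ≤ ((n : ℝ) / s) ^ (1 : ℝ) := Real.rpow_le_rpow_of_exponent_le h1 hα1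
      _ = _ := Real.rpow_one _
  calc ((n : ℝ) / s) ^ α * s ≤ (n : ℝ) / s * s := mul_le_mul_of_nonneg_right h2 hs0.le
    _ = n := div_mul_cancel₀ _ hs0.ne'

/-- **THE TWO-ROW VECTOR OF A CUT CUBE IS TWO-CENTRE SMALL/BOUNDED**: for rows `a ≠ a′` with `|a′−a| < n`, scalars
`|t| ≤ 1`, `|t′ − t| ≤ κ|a′−a|/n` (the values of the cut-off at the two rows) and `u = (n/|a′−a|)^α(t′T(a′,·) − tT(a,·))`:
`wsum2_{a,a′}(u) ≤ κc′ + (2c′ + (d+1)e^{δ}c_d)` from the weighted rows `c′` and differenced rows `c_d` of `T`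
(`u = (n/s)^α(t′−t)T(a′,·) + t·(n/s)^α(T(a′,·) − T(a,·))`, `(n/s)^α·s/n ≤ 1`, `wsum2_longRow_holder_le`).
[cite: Balaban1984PropagatorsII, (2.44) p.230, (2.64)/(2.67) p.234, bookkeeping] -/
theorem cube_pair_wsum2_le {δ : ℝ} (hδ : 0 ≤ δ) {n : ℕ} (hn : 1 ≤ n) (T : Matrix ↥(boxDom N) ↥(boxDom N) ℝ)
    {c' cd : ℝ} (hc' : 0 ≤ c') (hcd : 0 ≤ cd) (hrow : ∀ y, roww δ n T y ≤ c')
    (hdiff : ∀ (i : Fin (d + 1)) (v ve : ↥(boxDom N)), ve.1 = v.1 + Pi.single i 1 →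
      wsum δ n v (fun c => (n : ℝ) * (T ve c - T v c)) ≤ cd)
    {α : ℝ} (hα0 : 0 ≤ α) (hα1 : α ≤ 1) (a a' : ↥(boxDom N)) (hne : a'.1 ≠ a.1)
    (hnear : supNorm (a'.1 - a.1) ≤ n) {t t' κ : ℝ} (hκ : 0 ≤ κ) (ht : |t| ≤ 1)
    (htt : |t' - t| ≤ κ * supNorm (a'.1 - a.1) / n) :
    wsum2 δ n a a' (fun w => ((n : ℝ) / supNorm (a'.1 - a.1)) ^ α * (t' * T a' w - t * T a w))
      ≤ κ * c' + (2 * c' + ((d : ℝ) + 1) * Real.exp δ * cd) := by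
  have hn' : (0 : ℝ) < n := by exact_mod_cast hn
  have hs1 : 1 ≤ supNorm (a'.1 - a.1) := one_le_supNorm (sub_ne_zero.2 hne)
  have hs0 : 0 < supNorm (a'.1 - a.1) := lt_of_lt_of_le one_pos hs1
  set W : ℝ := ((n : ℝ) / supNorm (a'.1 - a.1)) ^ α with hW
  have hW0 : 0 ≤ W := Real.rpow_nonneg (div_nonneg hn'.le hs0.le) α
  have hWs : W * supNorm (a'.1 - a.1) ≤ n := holderWeight_mul_le hs1 hnear hα1
  -- the split
  have hsplit : (fun w => W * (t' * T a' w - t * T a w))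
      = fun w => W * (t' - t) * T a' w + t * (W * (T a' w - T a w)) := by
    funext w; ring
  rw [hsplit]
  have h1 : wsum2 δ n a a' (fun w => W * (t' - t) * T a' w) ≤ κ * c' := by
    refine (wsum2_le_wsum_right hδ n a a' _).trans ?_
    have hc : wsum δ n a' (fun w => W * (t' - t) * T a' w) = |W * (t' - t)| * roww δ n T a' := by
      unfold wsum roww
      rw [Finset.mul_sum]
      exact Finset.sum_congr rfl fun w _ => by rw [abs_mul (W * (t' - t))]; ring
    rw [hc, abs_mul, abs_of_nonneg hW0]
    have hWt : W * |t' - t| ≤ κ := by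
      calc W * |t' - t| ≤ W * (κ * supNorm (a'.1 - a.1) / n) := mul_le_mul_of_nonneg_left htt hW0
        _ = κ * ((W * supNorm (a'.1 - a.1)) / n) := by ring
        _ ≤ κ * 1 := mul_le_mul_of_nonneg_left ((div_le_one hn').2 hWs) hκ
        _ = κ := mul_one κ
    exact mul_le_mul hWt (hrow a') (roww_nonneg _ _ _ _) hκ
  have h2 : wsum2 δ n a a' (fun w => t * (W * (T a' w - T a w))) ≤ 2 * c' + ((d : ℝ) + 1) * Real.exp δ * cd := by
    have hL := wsum2_longRow_holder_le hδ hn T hc' hcd hrow hdiff hα0 hα1 a a' hne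
    have habs : wsum2 δ n a a' (fun w => t * (W * (T a' w - T a w)))
        = |t| * wsum2 δ n a a' (fun w => W * (T a' w - T a w)) := by
      unfold wsum2
      rw [Finset.mul_sum]
      exact Finset.sum_congr rfl fun w _ => by rw [abs_mul t]; ring
    rw [habs]
    have h0 : 0 ≤ wsum2 δ n a a' (fun w => W * (T a' w - T a w)) := wsum2_nonneg _ _ _ _ _
    calc |t| * wsum2 δ n a a' (fun w => W * (T a' w - T a w))
        ≤ 1 * wsum2 δ n a a' (fun w => W * (T a' w - T a w)) := mul_le_mul_of_nonneg_right ht h0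
      _ ≤ _ := by rw [one_mul]; exact hL
  exact (wsum2_add_le _ _ _ _ _ _).trans (add_le_add h1 h2)

/-- **… AND SO ARE ITS BOND DIFFERENCES**: with the weighted rows `c_s` of `T∂^*_μ` (`dstar`) and the column Hölder clause
`c_T` of `T` at the pair `a, a′`: `wsum2_{a,a′}(ξ^{−1}(u(fwd_μ·) − u(·))) ≤ κc_s + c_T`.
[cite: Balaban1984PropagatorsII, (2.44) p.230, (2.64)/(2.67) p.234, bookkeeping] -/
theorem cube_pair_diff_wsum2_le {δ : ℝ} (hδ : 0 ≤ δ) {n : ℕ} (hn : 1 ≤ n) (T : Matrix ↥(boxDom N) ↥(boxDom N) ℝ)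
    (μ : Fin (d + 1)) {cs cT : ℝ} (hds : ∀ y, roww δ n (dstar n μ T) y ≤ cs)
    {α : ℝ} (hα1 : α ≤ 1) (a a' : ↥(boxDom N)) (hne : a'.1 ≠ a.1) (hnear : supNorm (a'.1 - a.1) ≤ n)
    (hT : wsum2 δ n a a' (fun w => ((n : ℝ) / supNorm (a'.1 - a.1)) ^ α *
      ((n : ℝ) * ((T a' (fwd N μ w) - T a' w) - (T a (fwd N μ w) - T a w)))) ≤ cT)
    {t t' κ : ℝ} (hκ : 0 ≤ κ) (ht : |t| ≤ 1) (htt : |t' - t| ≤ κ * supNorm (a'.1 - a.1) / n) :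
    wsum2 δ n a a' (fun w => (n : ℝ) *
        ((((n : ℝ) / supNorm (a'.1 - a.1)) ^ α * (t' * T a' (fwd N μ w) - t * T a (fwd N μ w)))
          - (((n : ℝ) / supNorm (a'.1 - a.1)) ^ α * (t' * T a' w - t * T a w))))
      ≤ κ * cs + cT := by
  have hn' : (0 : ℝ) < n := by exact_mod_cast hn
  have hs1 : 1 ≤ supNorm (a'.1 - a.1) := one_le_supNorm (sub_ne_zero.2 hne)
  have hs0 : 0 < supNorm (a'.1 - a.1) := lt_of_lt_of_le one_pos hs1
  set W : ℝ := ((n : ℝ) / supNorm (a'.1 - a.1)) ^ α with hW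
  have hW0 : 0 ≤ W := Real.rpow_nonneg (div_nonneg hn'.le hs0.le) α
  have hWs : W * supNorm (a'.1 - a.1) ≤ n := holderWeight_mul_le hs1 hnear hα1
  have hcT : 0 ≤ cT := (wsum2_nonneg _ _ _ _ _).trans hT
  have hsplit : (fun w => (n : ℝ) * ((W * (t' * T a' (fwd N μ w) - t * T a (fwd N μ w)))
        - (W * (t' * T a' w - t * T a w))))
      = fun w => W * (t' - t) * ((n : ℝ) * (T a' (fwd N μ w) - T a' w))
          + t * (W * ((n : ℝ) * ((T a' (fwd N μ w) - T a' w) - (T a (fwd N μ w) - T a w)))) := by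
    funext w; ring
  rw [hsplit]
  have h1 : wsum2 δ n a a' (fun w => W * (t' - t) * ((n : ℝ) * (T a' (fwd N μ w) - T a' w))) ≤ κ * cs := by
    refine (wsum2_le_wsum_right hδ n a a' _).trans ?_
    have hc : wsum δ n a' (fun w => W * (t' - t) * ((n : ℝ) * (T a' (fwd N μ w) - T a' w)))
        = |W * (t' - t)| * roww δ n (dstar n μ T) a' := by
      rw [roww_dstar]
      unfold wsum
      rw [Finset.mul_sum]
      exact Finset.sum_congr rfl fun w _ => by rw [abs_mul (W * (t' - t))]; ring
    rw [hc, abs_mul, abs_of_nonneg hW0]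
    have hWt : W * |t' - t| ≤ κ := by
      calc W * |t' - t| ≤ W * (κ * supNorm (a'.1 - a.1) / n) := mul_le_mul_of_nonneg_left htt hW0
        _ = κ * ((W * supNorm (a'.1 - a.1)) / n) := by ring
        _ ≤ κ * 1 := mul_le_mul_of_nonneg_left ((div_le_one hn').2 hWs) hκ
        _ = κ := mul_one κ
    exact mul_le_mul hWt (hds a') (roww_nonneg _ _ _ _) hκ
  have h2 : wsum2 δ n a a' (fun w => t * (W * ((n : ℝ) * ((T a' (fwd N μ w) - T a' w)
      - (T a (fwd N μ w) - T a w))))) ≤ cT := by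
    have habs : wsum2 δ n a a' (fun w => t * (W * ((n : ℝ) * ((T a' (fwd N μ w) - T a' w)
        - (T a (fwd N μ w) - T a w)))))
        = |t| * wsum2 δ n a a' (fun w => W * ((n : ℝ) * ((T a' (fwd N μ w) - T a' w)
          - (T a (fwd N μ w) - T a w)))) := by
      unfold wsum2
      rw [Finset.mul_sum]
      exact Finset.sum_congr rfl fun w _ => by rw [abs_mul t]; ring
    rw [habs]
    calc |t| * wsum2 δ n a a' (fun w => W * ((n : ℝ) * ((T a' (fwd N μ w) - T a' w) - (T a (fwd N μ w) - T a w))))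
        ≤ 1 * cT := mul_le_mul ht hT (wsum2_nonneg _ _ _ _ _) zero_le_one
      _ = cT := one_mul _
  exact (wsum2_add_le _ _ _ _ _ _).trans (add_le_add h1 h2)

end CubePair

/-! ## §3 The Hölder-weighted long COLUMN differences of `R` are `O(M^{−1})` (two-centre form of the transposed (2.49)) -/

section ColumnPair

variable {ℓ k Mh : ℕ} {P : Fin (d + 1) → ℕ}

open Literature.MathematicalPhysics.QuantumFieldTheory.Balaban1983to89.B4PartitionUnity22 (D1 D1_nonneg D2 D2_nonneg
  hprof contDiff_hprof hasCompactSupport_hprof)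
open Literature.MathematicalPhysics.QuantumFieldTheory.Balaban1983to89.B6Eq238TwoLevelBox
open Literature.MathematicalPhysics.QuantumFieldTheory.Balaban1983to89.B6Partition236TwoLevelBox (ctrs abs_hq_le_one
  abs_lt_of_hq_ne_zero one_le_cubeW)
open Literature.MathematicalPhysics.QuantumFieldTheory.Balaban1983to89.B6Ineq249TwoLevelBox (near card_near_le
  mem_near_of_abs_lt emb_sub_emb)
open Literature.MathematicalPhysics.QuantumFieldTheory.Balaban1983to89.B6Prop22AdjTwoLevelBox (kComm_transpose
  mul_kComm_apply hLoc_lipschitz hLoc_laplacian_le roww_transpose_rOp_le)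
open Literature.MathematicalPhysics.QuantumFieldTheory.Balaban1983to89.B6Prop22HolderTwoLevelBox (exists_emb_eq_of_near)

/-- a sum over a finite type of a function vanishing off the image of an injection is the sum over the source. [folklore] -/
private theorem sum_eq_sum_image' {α β : Type*} [Fintype α] [Fintype β] [DecidableEq β] {e : α → β}
    (he : Function.Injective e) (F : β → ℝ) (hF : ∀ z, (∀ a, e a ≠ z) → F z = 0) : ∑ z, F z = ∑ a, F (e a) := by
  calc ∑ z, F z = ∑ z ∈ Finset.univ.image e, F z :=
        (Finset.sum_subset (Finset.subset_univ _) fun z _ hz =>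
          hF z fun a ha => hz (Finset.mem_image.2 ⟨a, Finset.mem_univ _, ha⟩)).symm
    _ = ∑ a, F (e a) := Finset.sum_image fun a _ a' _ h => he h

/-- a sum of non-negative terms, each `≤ B`, non-zero only on terms indexed injectively by `T`: `≤ |T|·B`. [folklore] -/
private theorem sum_le_card_mul' {ι σ : Type*} [Fintype ι] [DecidableEq σ] (f : ι → ℝ) (key : ι → σ)
    (hkey : Function.Injective key) (T : Finset σ) (hT : ∀ i, f i ≠ 0 → key i ∈ T) {B : ℝ} (hB : 0 ≤ B)
    (hf : ∀ i, f i ≤ B) : ∑ i, f i ≤ T.card * B := by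
  classical
  rw [← Finset.sum_filter_ne_zero]
  have hcard : (Finset.univ.filter fun i => f i ≠ 0).card ≤ T.card :=
    Finset.card_le_card_of_injOn key (fun i hi => by
      rw [Finset.coe_filter] at hi; exact hT i hi.2) (fun i _ j _ h => hkey h)
  calc ∑ i ∈ Finset.univ.filter (fun i => f i ≠ 0), f i
      ≤ (Finset.univ.filter fun i => f i ≠ 0).card • B := Finset.sum_le_card_nsmul _ _ _ fun i _ => hf i
    _ = ((Finset.univ.filter fun i => f i ≠ 0).card : ℝ) * B := by rw [nsmul_eq_mul]
    _ ≤ T.card * B := by gcongr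

variable {q : Fin (d + 1) → ℤ} in
/-- the two-centre functional of the difference of two EMBEDDED rows of a padded cube kernel is the cube functional.
[cite: Balaban1983RegularityDecay, §2 p.575, dictionary] -/
theorem wsum2_pad_emb_pair (hP : ∀ i, 1 ≤ P i) (hq : q ∈ ctrs P) (δ : ℝ) (n : ℕ) (W : ℝ)
    (T : Matrix ↥(Box d ℓ k (fun i => (ℓ + 1) * cubeM' Mh P q i)) ↥(Box d ℓ k (fun i => (ℓ + 1) * cubeM' Mh P q i)) ℝ)
    (a a' : ↥(Box d ℓ k (fun i => (ℓ + 1) * cubeM' Mh P q i))) :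
    wsum2 δ n (emb ℓ k Mh P q hP hq a) (emb ℓ k Mh P q hP hq a') (fun z =>
        W * (((res (emb ℓ k Mh P q hP hq))ᵀ * T * res (emb ℓ k Mh P q hP hq)) (emb ℓ k Mh P q hP hq a') z
          - ((res (emb ℓ k Mh P q hP hq))ᵀ * T * res (emb ℓ k Mh P q hP hq)) (emb ℓ k Mh P q hP hq a) z))
      = wsum2 δ n a a' (fun c => W * (T a' c - T a c)) := by
  have hinj := emb_injective (ℓ := ℓ) (k := k) (Mh := Mh) hP hq
  unfold wsum2
  have hoff : ∀ z ∈ (Finset.univ : Finset ↥(Box d ℓ k (fun i => (ℓ + 1) * (Mh * P i)))),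
      z ∉ Finset.univ.image (emb ℓ k Mh P q hP hq) →
      |W * (((res (emb ℓ k Mh P q hP hq))ᵀ * T * res (emb ℓ k Mh P q hP hq)) (emb ℓ k Mh P q hP hq a') z
          - ((res (emb ℓ k Mh P q hP hq))ᵀ * T * res (emb ℓ k Mh P q hP hq)) (emb ℓ k Mh P q hP hq a) z)|
        * Real.exp (δ * min (supNorm ((emb ℓ k Mh P q hP hq a).1 - z.1))
            (supNorm ((emb ℓ k Mh P q hP hq a').1 - z.1)) / n) = 0 := by
    intro z _ hz
    have hne : ∀ b, emb ℓ k Mh P q hP hq b ≠ z := fun b hb =>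
      hz (Finset.mem_image.2 ⟨b, Finset.mem_univ _, hb⟩)
    rw [mul_res_apply_off _ _ _ hne, mul_res_apply_off _ _ _ hne]
    simp
  rw [← Finset.sum_subset (Finset.subset_univ _) hoff, Finset.sum_image (fun b _ b' _ h => hinj h)]
  refine Finset.sum_congr rfl fun c _ => ?_
  simp only
  rw [Matrix.mul_assoc, transpose_res_mul_apply_img hinj, transpose_res_mul_apply_img hinj, mul_res_apply_img hinj,
    mul_res_apply_img hinj, emb_sub_emb hP hq, emb_sub_emb hP hq]

variable {N : Fin (d + 1) → ℕ} in
/-- `wsum2` is blind to the sign of the function. [folklore] -/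
private theorem wsum2_neg_fun (δ : ℝ) (n : ℕ) (x x' : ↥(boxDom N)) (g : ↥(boxDom N) → ℝ) :
    wsum2 δ n x x' (fun z => -g z) = wsum2 δ n x x' g := by
  unfold wsum2
  exact Finset.sum_congr rfl fun z _ => by rw [abs_neg]

/-- **ONE TERM OF `Rᵀ`, TWO ROWS**: for two sites `a ≠ a′` of the cube `□_q` within the mesh of each other, the
Hölder-weighted two-centre functional of the difference of the rows `emb a′`, `emb a` of `(resᵀ·K_q(h_q)G′(□_q)h_q·res)ᵀ`
is at most `κ₁(1+e^{δ})(d+1)(κ₁c_s + c_T) + (κ₂ + (a_j+a)Le^{δL}κ₁)(κ₁c′ + 2c′ + (d+1)e^{δ}c_d)` — `K(h)ᵀ = −K(h)`, the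
symmetry of `G′(□_q)`, `wsum2_kComm_le` applied to the two-row vector `u = W(h(a′)Ĝ(a′,·) − h(a)Ĝ(a,·))` and §2.
[cite: Balaban1984PropagatorsII, (2.38) p.229, (2.40)/(2.44) p.230, (2.67) p.234] -/
theorem wsum2_transpose_bPad_pair_le (hℓ : 1 ≤ ℓ) (hMh : 1 ≤ Mh) (hP : ∀ i, 1 ≤ P i) {aj a m2 : ℝ}
    (haj : 0 < aj) (ha : 0 ≤ a) {Λ : Finset ↥(boxDom (fun i => (ℓ + 1) * (Mh * P i)))}
    (hΛ : IsBlockUnion ℓ (fun i => Mh * P i) Λ) (q : ↥(ctrs P)) {δ c' cd cs cT κ₁ κ₂ : ℝ} (hδ : 0 ≤ δ)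
    (hc' : 0 ≤ c') (hcd : 0 ≤ cd) (hκ₁ : 0 ≤ κ₁) (hκ₂ : 0 ≤ κ₂)
    (hG : ∀ b, roww δ ((ℓ + 1) ^ k) (cubeG ℓ k Mh P aj a m2 Λ hP q) b ≤ c')
    (hGd : ∀ (i : Fin (d + 1)) (v ve : ↥(Box d ℓ k (fun i => (ℓ + 1) * cubeM' Mh P q.1 i))),
      ve.1 = v.1 + Pi.single i 1 →
      wsum δ ((ℓ + 1) ^ k) v (fun c => (((ℓ + 1) ^ k : ℕ) : ℝ) *
        (cubeG ℓ k Mh P aj a m2 Λ hP q ve c - cubeG ℓ k Mh P aj a m2 Λ hP q v c)) ≤ cd)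
    (hGs : ∀ (μ : Fin (d + 1)) b, roww δ ((ℓ + 1) ^ k) (dstar ((ℓ + 1) ^ k) μ (cubeG ℓ k Mh P aj a m2 Λ hP q)) b ≤ cs)
    (hLip : ∀ z z' : ↥(Box d ℓ k (fun i => (ℓ + 1) * cubeM' Mh P q.1 i)),
      |hLoc ℓ k Mh P q.1 z' - hLoc ℓ k Mh P q.1 z| ≤ κ₁ * supNorm (z'.1 - z.1) / (((ℓ + 1) ^ k : ℕ) : ℝ))
    (hLap : ∀ z : ↥(Box d ℓ k (fun i => (ℓ + 1) * cubeM' Mh P q.1 i)),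
      |((((ℓ + 1) ^ k : ℕ) : ℝ)) ^ 2 * ∑ z' ∈ boxNbrs _ z, (hLoc ℓ k Mh P q.1 z' - hLoc ℓ k Mh P q.1 z)| ≤ κ₂)
    {α : ℝ} (hα0 : 0 ≤ α) (hα1 : α ≤ 1)
    (b b' : ↥(Box d ℓ k (fun i => (ℓ + 1) * cubeM' Mh P q.1 i))) (hne : b'.1 ≠ b.1)
    (hnear : supNorm (b'.1 - b.1) ≤ (((ℓ + 1) ^ k : ℕ) : ℝ))
    (hT : ∀ μ : Fin (d + 1), wsum2 δ ((ℓ + 1) ^ k) b b' (fun w => ((((ℓ + 1) ^ k : ℕ) : ℝ) / supNorm (b'.1 - b.1)) ^ α *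
      ((((ℓ + 1) ^ k : ℕ) : ℝ) * ((cubeG ℓ k Mh P aj a m2 Λ hP q b' (fwd _ μ w) - cubeG ℓ k Mh P aj a m2 Λ hP q b' w)
        - (cubeG ℓ k Mh P aj a m2 Λ hP q b (fwd _ μ w) - cubeG ℓ k Mh P aj a m2 Λ hP q b w)))) ≤ cT) :
    wsum2 δ ((ℓ + 1) ^ k) (emb ℓ k Mh P q.1 hP q.2 b) (emb ℓ k Mh P q.1 hP q.2 b') (fun z =>
        ((((ℓ + 1) ^ k : ℕ) : ℝ) / supNorm (b'.1 - b.1)) ^ α *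
          ((bPad ℓ k Mh P aj a m2 Λ hP q)ᵀ (emb ℓ k Mh P q.1 hP q.2 b') z
            - (bPad ℓ k Mh P aj a m2 Λ hP q)ᵀ (emb ℓ k Mh P q.1 hP q.2 b) z))
      ≤ κ₁ * (1 + Real.exp δ) * ((d + 1) * (κ₁ * cs + cT))
          + (κ₂ + (aj + a) * ((ℓ : ℝ) + 1) * Real.exp (δ * ((ℓ : ℝ) + 1)) * κ₁)
            * (κ₁ * c' + (2 * c' + ((d : ℝ) + 1) * Real.exp δ * cd)) := by
  have hn1 : 1 ≤ (ℓ + 1) ^ k := Nat.one_le_pow _ _ (by omega)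
  have hEs : (cubeOp ℓ k Mh P aj a m2 Λ hP q).IsSymm := twoLevelOp_isSymm _ _ _ _ _ _ _
  have hGsym : (cubeG ℓ k Mh P aj a m2 Λ hP q)ᵀ = cubeG ℓ k Mh P aj a m2 Λ hP q :=
    (gTwoLevel_isSymm _ _ _ _ _ _ _).eq
  have hKs : (kComm (cubeOp ℓ k Mh P aj a m2 Λ hP q) (hLoc ℓ k Mh P q.1))ᵀ
      = -kComm (cubeOp ℓ k Mh P aj a m2 Λ hP q) (hLoc ℓ k Mh P q.1) := kComm_transpose _ hEs _
  have hcT : 0 ≤ cT := (wsum2_nonneg _ _ _ _ _).trans (hT 0)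
  -- the transpose of the padded operator
  have hTr : (bPad ℓ k Mh P aj a m2 Λ hP q)ᵀ
      = -((res (emb ℓ k Mh P q.1 hP q.2))ᵀ * (Matrix.diagonal (hLoc ℓ k Mh P q.1)
          * (cubeG ℓ k Mh P aj a m2 Λ hP q * kComm (cubeOp ℓ k Mh P aj a m2 Λ hP q) (hLoc ℓ k Mh P q.1)))
          * res (emb ℓ k Mh P q.1 hP q.2)) := by
    unfold bPad
    rw [Matrix.transpose_mul, Matrix.transpose_mul, Matrix.transpose_transpose, Matrix.transpose_mul,
      Matrix.transpose_mul, Matrix.diagonal_transpose, hGsym, hKs]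
    simp only [Matrix.mul_neg, Matrix.neg_mul, Matrix.mul_assoc]
  set W : ℝ := ((((ℓ + 1) ^ k : ℕ) : ℝ) / supNorm (b'.1 - b.1)) ^ α with hW
  -- the padded two-row functional is the cube functional of `−K u`
  set Mq := Matrix.diagonal (hLoc ℓ k Mh P q.1)
      * (cubeG ℓ k Mh P aj a m2 Λ hP q * kComm (cubeOp ℓ k Mh P aj a m2 Λ hP q) (hLoc ℓ k Mh P q.1)) with hMq
  set u : ↥(Box d ℓ k (fun i => (ℓ + 1) * cubeM' Mh P q.1 i)) → ℝ := fun w =>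
    W * (hLoc ℓ k Mh P q.1 b' * cubeG ℓ k Mh P aj a m2 Λ hP q b' w
      - hLoc ℓ k Mh P q.1 b * cubeG ℓ k Mh P aj a m2 Λ hP q b w) with hu
  have hrows : ∀ c, W * (Mq b' c - Mq b c) = -((kComm (cubeOp ℓ k Mh P aj a m2 Λ hP q) (hLoc ℓ k Mh P q.1) *ᵥ u) c) := by
    intro c
    rw [hMq, Matrix.diagonal_mul, Matrix.diagonal_mul, mul_kComm_apply _ _ hEs, mul_kComm_apply _ _ hEs]
    rw [hu, kComm_mulVec, kComm_mulVec, kComm_mulVec]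
    have e1 : ∀ (s : ℝ) (f : ↥(Box d ℓ k (fun i => (ℓ + 1) * cubeM' Mh P q.1 i)) → ℝ),
        s * -(∑ x'', f x'') = ∑ x'', -(s * f x'') := by
      intro s f
      rw [mul_neg, Finset.mul_sum, ← Finset.sum_neg_distrib]
    rw [e1, e1, ← Finset.sum_sub_distrib, Finset.mul_sum, ← Finset.sum_neg_distrib]
    exact Finset.sum_congr rfl fun w _ => by ring
  have hfun : (fun z => W * ((bPad ℓ k Mh P aj a m2 Λ hP q)ᵀ (emb ℓ k Mh P q.1 hP q.2 b') z
        - (bPad ℓ k Mh P aj a m2 Λ hP q)ᵀ (emb ℓ k Mh P q.1 hP q.2 b) z))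
      = fun z => -(W * (((res (emb ℓ k Mh P q.1 hP q.2))ᵀ * Mq * res (emb ℓ k Mh P q.1 hP q.2))
          (emb ℓ k Mh P q.1 hP q.2 b') z
        - ((res (emb ℓ k Mh P q.1 hP q.2))ᵀ * Mq * res (emb ℓ k Mh P q.1 hP q.2)) (emb ℓ k Mh P q.1 hP q.2 b) z)) := by
    funext z
    rw [hTr]
    simp only [Matrix.neg_apply]
    ring
  rw [hfun, wsum2_neg_fun, wsum2_pad_emb_pair hP q.2]
  have hfun2 : (fun c => W * (Mq b' c - Mq b c))
      = fun c => -((kComm (cubeOp ℓ k Mh P aj a m2 Λ hP q) (hLoc ℓ k Mh P q.1) *ᵥ u) c) := funext hrows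
  rw [hfun2, wsum2_neg_fun]
  -- the two-centre (2.40) bound and the cube pair functionals
  unfold cubeOp
  have hK := wsum2_kComm_le hn1 haj ha (m2 := m2) (isBlockUnion_lamLoc hP q.2 hΛ) hδ hκ₁
    (hLoc ℓ k Mh P q.1) hLip hLap u b b'
  refine hK.trans ?_
  -- the values of the cut-off at the two rows
  have ht : |hLoc ℓ k Mh P q.1 b| ≤ 1 := by rw [← hΩ_emb hMh hP q.2]; exact abs_hq_le_one _ _ _ _
  have htt : |hLoc ℓ k Mh P q.1 b' - hLoc ℓ k Mh P q.1 b| ≤ κ₁ * supNorm (b'.1 - b.1) / (((ℓ + 1) ^ k : ℕ) : ℝ) :=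
    hLip b b'
  have hU : wsum2 δ ((ℓ + 1) ^ k) b b' u ≤ κ₁ * c' + (2 * c' + ((d : ℝ) + 1) * Real.exp δ * cd) :=
    cube_pair_wsum2_le hδ hn1 _ hc' hcd hG hGd hα0 hα1 b b' hne hnear hκ₁ ht htt
  have hUd : ∀ μ : Fin (d + 1), wsum2 δ ((ℓ + 1) ^ k) b b' (fun w => (((ℓ + 1) ^ k : ℕ) : ℝ) * (u (fwd _ μ w) - u w))
      ≤ κ₁ * cs + cT := by
    intro μ
    have := cube_pair_diff_wsum2_le hδ hn1 (cubeG ℓ k Mh P aj a m2 Λ hP q) μ (hGs μ) hα1 b b' hne hnear (hT μ)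
      hκ₁ ht htt
    rw [hu]
    exact this
  have hsum : ∑ μ : Fin (d + 1), wsum2 δ ((ℓ + 1) ^ k) b b' (fun w => (((ℓ + 1) ^ k : ℕ) : ℝ) * (u (fwd _ μ w) - u w))
      ≤ (d + 1) * (κ₁ * cs + cT) := by
    calc ∑ μ : Fin (d + 1), wsum2 δ ((ℓ + 1) ^ k) b b' (fun w => (((ℓ + 1) ^ k : ℕ) : ℝ) * (u (fwd _ μ w) - u w))
        ≤ ∑ _μ : Fin (d + 1), (κ₁ * cs + cT) := Finset.sum_le_sum fun μ _ => hUd μ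
      _ = (d + 1) * (κ₁ * cs + cT) := by
          rw [Finset.sum_const, Finset.card_univ, Fintype.card_fin, nsmul_eq_mul]; push_cast; ring
  have hco : 0 ≤ κ₂ + (aj + a) * ((ℓ : ℝ) + 1) * Real.exp (δ * ((ℓ : ℝ) + 1)) * κ₁ := by positivity
  have t1 := mul_le_mul_of_nonneg_left hsum (mul_nonneg hκ₁ (by positivity : (0 : ℝ) ≤ 1 + Real.exp δ))
  have t2 := mul_le_mul_of_nonneg_left hU hco
  exact add_le_add t1 t2

end ColumnPair

section ColumnPairAssembly

variable {ℓ k Mh : ℕ} {P : Fin (d + 1) → ℕ}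

open Literature.MathematicalPhysics.QuantumFieldTheory.Balaban1983to89.B4PartitionUnity22 (D1 D1_nonneg D2 D2_nonneg
  hprof contDiff_hprof hasCompactSupport_hprof)
open Literature.MathematicalPhysics.QuantumFieldTheory.Balaban1983to89.B6Eq238TwoLevelBox
open Literature.MathematicalPhysics.QuantumFieldTheory.Balaban1983to89.B6Partition236TwoLevelBox (ctrs abs_hq_le_one
  abs_lt_of_hq_ne_zero one_le_cubeW)
open Literature.MathematicalPhysics.QuantumFieldTheory.Balaban1983to89.B6Ineq249TwoLevelBox (near card_near_le
  mem_near_of_abs_lt emb_sub_emb)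
open Literature.MathematicalPhysics.QuantumFieldTheory.Balaban1983to89.B6Ineq243AdjTwoLevelBox (ineq243_twoLevel_dstar_roww)
open Literature.MathematicalPhysics.QuantumFieldTheory.Balaban1983to89.B6Prop22AdjTwoLevelBox (hLoc_lipschitz
  hLoc_laplacian_le roww_transpose_rOp_le)
open Literature.MathematicalPhysics.QuantumFieldTheory.Balaban1983to89.B6Prop22HolderTwoLevelBox (exists_emb_eq_of_near)
open Literature.MathematicalPhysics.QuantumFieldTheory.Balaban1983to89.B6Ineq243HolderDualTwoLevelBox
  (ineq243_twoLevel_holderDual_wsum2)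

variable {N : Fin (d + 1) → ℕ} in
/-- `wsum2` of a finite sum of functions is at most the sum of the `wsum2`. [folklore] -/
private theorem wsum2_sum_le {ι : Type*} (s : Finset ι) (δ : ℝ) (n : ℕ) (x x' : ↥(boxDom N))
    (g : ι → ↥(boxDom N) → ℝ) : wsum2 δ n x x' (fun z => ∑ i ∈ s, g i z) ≤ ∑ i ∈ s, wsum2 δ n x x' (g i) := by
  classical
  induction s using Finset.induction_on with
  | empty =>
      simp only [Finset.sum_empty]
      unfold wsum2
      simp
  | insert i s hi ih =>
      rw [Finset.sum_insert hi]
      have e : (fun z => ∑ j ∈ insert i s, g j z) = fun z => g i z + ∑ j ∈ s, g j z :=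
        funext fun z => Finset.sum_insert hi
      rw [e]
      exact (wsum2_add_le _ _ _ _ _ _).trans (add_le_add le_rfl ih)

/-- a column of the padded (2.44)-operator at a site not carrying `h_q` vanishes: `(bPad q)ᵀ(x, ·) = 0` if `h_q(x) = 0`.
[cite: Balaban1984PropagatorsII, (2.38) p.229, (2.44) p.230, dictionary] -/
theorem bPad_transpose_row_eq_zero (hMh : 1 ≤ Mh) (hP : ∀ i, 1 ≤ P i) {aj a m2 : ℝ}
    {Λ : Finset ↥(boxDom (fun i => (ℓ + 1) * (Mh * P i)))} (q : ↥(ctrs P))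
    {x : ↥(Box d ℓ k (fun i => (ℓ + 1) * (Mh * P i)))} (hx : hΩ ℓ k Mh P q.1 x = 0)
    (z : ↥(Box d ℓ k (fun i => (ℓ + 1) * (Mh * P i)))) : (bPad ℓ k Mh P aj a m2 Λ hP q)ᵀ x z = 0 := by
  rw [Matrix.transpose_apply]
  unfold bPad
  by_cases hxi : ∃ b, emb ℓ k Mh P q.1 hP q.2 b = x
  · obtain ⟨b, rfl⟩ := hxi
    have hinj := emb_injective (ℓ := ℓ) (k := k) (Mh := Mh) hP q.2
    rw [mul_res_apply_img hinj, Matrix.mul_apply]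
    refine Finset.sum_eq_zero fun w _ => ?_
    rw [Matrix.mul_diagonal, ← hΩ_emb hMh hP q.2, hx, mul_zero, mul_zero]
  · push Not at hxi
    exact mul_res_apply_off _ _ _ hxi

set_option maxHeartbeats 1600000 in
/-- **THE HÖLDER-WEIGHTED LONG COLUMN DIFFERENCES OF `R` ARE `O(M^{−1})`** (two-centre form): there are `δ₅, C_Ψ > 0`
(functions of `d`, `ℓ`, `α`, the windows) such that for EVERY mesh `k ≥ 1`, `M_h ≥ 3`, volume, block union, window point
and all `x ≠ x′`:
`Σ_y (n/|x′−x|_∞)^α·|R(y,x′) − R(y,x)|·e^{δ₅min(|x−y|,|x′−y|)/n} ≤ C_Ψ/(L·M_h)`.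
Route: for `|x′−x| ≥ n` the weight is `≤ 1` and the two columns are summed separately
(`B6Prop22AdjTwoLevelBox.roww_transpose_rOp_le`); for `|x′−x| < n` every cube carrying `h_q` at `x` or `x′` contains both
(`B6Prop22HolderTwoLevelBox.exists_emb_eq_of_near`), its term is `wsum2_transpose_bPad_pair_le` with `κ₁ = (d+1)sup|h′|/M`,
`κ₂ = (d+1)sup|h″|/M²`, and at most `2·2^{d+1}` cubes contribute.
[cite: Balaban1984PropagatorsII, (2.44) p.230, (2.49)/(2.51) p.232, (2.67) p.234] -/
theorem wsum2_transpose_rOp_pair_le (d ℓ : ℕ) (hℓ : 1 ≤ ℓ) (aminus aplus m2plus a2minus a2plus : ℝ) (ha : 0 < aminus)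
    (ha2 : 0 < a2minus) (α : ℝ) (hα0 : 0 ≤ α) (hα1 : α < 1) :
    ∃ δ₅ CΨ : ℝ, 0 < δ₅ ∧ 0 < CΨ ∧ ∀ (k : ℕ), 1 ≤ k → ∀ (aj m2 a : ℝ), aminus ≤ aj → aj ≤ aplus → 0 ≤ m2 →
      m2 ≤ m2plus → a2minus ≤ a → a ≤ a2plus → ∀ (Mh : ℕ), 3 ≤ Mh → ∀ (P : Fin (d + 1) → ℕ) (hP : ∀ i, 1 ≤ P i)
        (Λ : Finset ↥(boxDom (fun i => (ℓ + 1) * (Mh * P i)))), IsBlockUnion ℓ (fun i => Mh * P i) Λ →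
        ∀ (x x' : ↥(Box d ℓ k (fun i => (ℓ + 1) * (Mh * P i)))), x'.1 ≠ x.1 →
          wsum2 δ₅ ((ℓ + 1) ^ k) x x' (fun y => ((((ℓ + 1) ^ k : ℕ) : ℝ) / supNorm (x'.1 - x.1)) ^ α *
            ((B6Eq250.rOp (twoLevelOp ((ℓ + 1) ^ k) ℓ aj a m2 (fun i => Mh * P i) Λ)
                (hDiag ℓ k Mh P) (gPad ℓ k Mh P aj a m2 Λ hP))ᵀ x' y
              - (B6Eq250.rOp (twoLevelOp ((ℓ + 1) ^ k) ℓ aj a m2 (fun i => Mh * P i) Λ)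
                (hDiag ℓ k Mh P) (gPad ℓ k Mh P aj a m2 Λ hP))ᵀ x y)) ≤ CΨ / (((ℓ : ℝ) + 1) * Mh) := by
  obtain ⟨δa, c', hδa, hc', h243⟩ := ineq243_twoLevel_roww d ℓ hℓ aminus aplus m2plus a2minus a2plus ha ha2
  obtain ⟨δd, cd, hδd, hcd, h243d⟩ := ineq243_twoLevel_deriv_wsum d ℓ hℓ aminus aplus m2plus a2minus a2plus ha ha2
  obtain ⟨δb, cs, hδb, hcs, h243s⟩ := ineq243_twoLevel_dstar_roww d ℓ hℓ aminus aplus m2plus a2minus a2plus ha ha2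
  obtain ⟨δT, cT, hδT, hcT, h243T⟩ :=
    ineq243_twoLevel_holderDual_wsum2 d ℓ hℓ aminus aplus m2plus a2minus a2plus ha ha2 α hα0 hα1
  obtain ⟨δ₃, CR, hδ₃, hCR, hR₃⟩ := roww_transpose_rOp_le d ℓ hℓ aminus aplus m2plus a2minus a2plus ha ha2
  have hD1 := D1_nonneg contDiff_hprof hasCompactSupport_hprof
  have hD2 := D2_nonneg contDiff_hprof hasCompactSupport_hprof
  obtain ⟨δ₅, hδ₅⟩ : ∃ δ₅ : ℝ, δ₅ = min (min (min δa δd) (min δb δT)) δ₃ := ⟨_, rfl⟩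
  have hδ₅0 : 0 < δ₅ := by rw [hδ₅]; exact lt_min (lt_min (lt_min hδa hδd) (lt_min hδb hδT)) hδ₃
  have hδ₅a : δ₅ ≤ δa := by rw [hδ₅]; exact (min_le_left _ _).trans ((min_le_left _ _).trans (min_le_left _ _))
  have hδ₅d : δ₅ ≤ δd := by rw [hδ₅]; exact (min_le_left _ _).trans ((min_le_left _ _).trans (min_le_right _ _))
  have hδ₅b : δ₅ ≤ δb := by rw [hδ₅]; exact (min_le_left _ _).trans ((min_le_right _ _).trans (min_le_left _ _))
  have hδ₅T : δ₅ ≤ δT := by rw [hδ₅]; exact (min_le_left _ _).trans ((min_le_right _ _).trans (min_le_right _ _))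
  have hδ₅3 : δ₅ ≤ δ₃ := by rw [hδ₅]; exact min_le_right _ _
  have hL0 : (0 : ℝ) ≤ (ℓ : ℝ) + 1 := by positivity
  -- the `M`-free constants
  obtain ⟨A₁, hA₁⟩ : ∃ A₁ : ℝ, A₁ = (d + 1) * D1 hprof := ⟨_, rfl⟩
  obtain ⟨A₂, hA₂⟩ : ∃ A₂ : ℝ, A₂ = (d + 1) * D2 hprof := ⟨_, rfl⟩
  obtain ⟨ap, hap⟩ : ∃ ap : ℝ, ap = (|aplus| + |a2plus|) * ((ℓ : ℝ) + 1) * Real.exp (δ₅ * ((ℓ : ℝ) + 1)) :=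
    ⟨_, rfl⟩
  obtain ⟨cL, hcL⟩ : ∃ cL : ℝ, cL = 2 * c' + ((d : ℝ) + 1) * Real.exp δ₅ * cd := ⟨_, rfl⟩
  have hA₁0 : 0 ≤ A₁ := by rw [hA₁]; positivity
  have hA₂0 : 0 ≤ A₂ := by rw [hA₂]; positivity
  have hap0 : 0 ≤ ap := by rw [hap]; positivity
  have hcL0 : 0 ≤ cL := by rw [hcL]; positivity
  obtain ⟨CΨ₀, hCΨ₀⟩ : ∃ CΨ₀ : ℝ,
      CΨ₀ = A₁ * (1 + Real.exp δ₅) * ((d + 1) * (A₁ * cs + cT)) + (A₂ + ap * A₁) * (A₁ * c' + cL) := ⟨_, rfl⟩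
  have hCΨ₀0 : 0 ≤ CΨ₀ := by rw [hCΨ₀]; positivity
  refine ⟨δ₅, 2 * CR + 2 * 2 ^ (d + 1) * CΨ₀ + 1, hδ₅0, by positivity, ?_⟩
  intro k hk aj m2 a e1 e2 e3 e4 e5 e6 Mh hMh P hP Λ hΛ x x' hne
  have hMh1 : 1 ≤ Mh := le_trans (by norm_num) hMh
  have hn1 : 1 ≤ (ℓ + 1) ^ k := Nat.one_le_pow _ _ (by omega)
  have hnr : (0 : ℝ) < (((ℓ + 1) ^ k : ℕ) : ℝ) := by exact_mod_cast hn1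
  have hN1 : 1 ≤ (ℓ + 1) ^ k * ((ℓ + 1) * Mh) := Nat.one_le_iff_ne_zero.2 (by positivity)
  have haj : 0 < aj := lt_of_lt_of_le ha e1
  have ha0 : 0 ≤ a := (lt_of_lt_of_le ha2 e5).le
  obtain ⟨M, hM⟩ : ∃ M : ℝ, M = ((ℓ : ℝ) + 1) * Mh := ⟨_, rfl⟩
  have hM1 : (1 : ℝ) ≤ M := by
    have : (1 : ℝ) ≤ Mh := by exact_mod_cast hMh1
    have : (1 : ℝ) ≤ (ℓ : ℝ) + 1 := by linarith [(Nat.cast_nonneg ℓ : (0 : ℝ) ≤ ℓ)]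
    rw [hM]; nlinarith
  have hMpos : 0 < M := by linarith
  rw [← hM]
  have hs1 : 1 ≤ supNorm (x'.1 - x.1) := one_le_supNorm (sub_ne_zero.2 hne)
  have hs0 : 0 < supNorm (x'.1 - x.1) := lt_of_lt_of_le one_pos hs1
  set W : ℝ := ((((ℓ + 1) ^ k : ℕ) : ℝ) / supNorm (x'.1 - x.1)) ^ α with hW
  have hW0 : 0 ≤ W := Real.rpow_nonneg (div_nonneg hnr.le hs0.le) α
  set Rt := (B6Eq250.rOp (twoLevelOp ((ℓ + 1) ^ k) ℓ aj a m2 (fun i => Mh * P i) Λ)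
      (hDiag ℓ k Mh P) (gPad ℓ k Mh P aj a m2 Λ hP))ᵀ with hRt
  have hfinal0 : 0 ≤ 2 * 2 ^ (d + 1) * CΨ₀ + 1 := by positivity
  rcases le_or_gt ((((ℓ + 1) ^ k : ℕ) : ℝ)) (supNorm (x'.1 - x.1)) with hfar | hnear
  · -- FAR: the weight is `≤ 1`, the two columns are summed separately
    have hW1 : W ≤ 1 := by
      rw [hW]; exact Real.rpow_le_one (div_nonneg hnr.le hs0.le) ((div_le_one hs0).2 hfar) hα0
    have hsplit := wsum2_split_le hδ₅0.le ((ℓ + 1) ^ k) x x' (fun y => W * (Rt x' y - Rt x y))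
      (fun y => W * (-Rt x y)) (fun y => W * Rt x' y) (fun y => by ring)
    have hrow : ∀ p : ↥(Box d ℓ k (fun i => (ℓ + 1) * (Mh * P i))), roww δ₅ ((ℓ + 1) ^ k) Rt p ≤ CR / M := by
      intro p
      rw [hRt, hM]
      exact (roww_mono hδ₅3 _ _ _).trans (hR₃ k hk aj m2 a e1 e2 e3 e4 e5 e6 Mh hMh P hP Λ hΛ p)
    have h1 : wsum δ₅ ((ℓ + 1) ^ k) x (fun y => W * (-Rt x y)) ≤ CR / M := by
      rw [wsum_mul_left _ _ _ hW0]
      have : wsum δ₅ ((ℓ + 1) ^ k) x (fun y => -Rt x y) = roww δ₅ ((ℓ + 1) ^ k) Rt x := by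
        unfold wsum roww; exact Finset.sum_congr rfl fun y _ => by rw [abs_neg]
      rw [this]
      exact (mul_le_of_le_one_left (roww_nonneg _ _ _ _) hW1).trans (hrow x)
    have h2 : wsum δ₅ ((ℓ + 1) ^ k) x' (fun y => W * Rt x' y) ≤ CR / M := by
      rw [wsum_mul_left _ _ _ hW0]
      have : wsum δ₅ ((ℓ + 1) ^ k) x' (fun y => Rt x' y) = roww δ₅ ((ℓ + 1) ^ k) Rt x' := rfl
      rw [this]
      exact (mul_le_of_le_one_left (roww_nonneg _ _ _ _) hW1).trans (hrow x')
    calc wsum2 δ₅ ((ℓ + 1) ^ k) x x' (fun y => W * (Rt x' y - Rt x y)) ≤ CR / M + CR / M :=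
          hsplit.trans (add_le_add h1 h2)
      _ = (2 * CR) / M := by ring
      _ ≤ (2 * CR + 2 * 2 ^ (d + 1) * CΨ₀ + 1) / M := by gcongr; linarith
  · -- NEAR: per-cube two-row terms and the overlap count
    obtain ⟨κ₁, hκ₁⟩ : ∃ κ₁ : ℝ, κ₁ = A₁ / M := ⟨_, rfl⟩
    obtain ⟨κ₂, hκ₂⟩ : ∃ κ₂ : ℝ, κ₂ = (d + 1) * (D2 hprof / M ^ 2) := ⟨_, rfl⟩
    have hκ₁0 : 0 ≤ κ₁ := by rw [hκ₁]; positivity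
    have hκ₂0 : 0 ≤ κ₂ := by rw [hκ₂]; positivity
    have hκ₁A : κ₁ ≤ A₁ := by rw [hκ₁]; exact div_le_self hA₁0 hM1
    have hM' : ∀ q : ↥(ctrs P), ∀ i, 1 ≤ cubeM' Mh P q.1 i := fun q i =>
      Nat.one_le_iff_ne_zero.2 (Nat.mul_ne_zero_iff.2 ⟨by omega, by have := (one_le_cubeW hP q.2 i).1; omega⟩)
    -- the per-cube constant and its size
    obtain ⟨BM, hBM⟩ : ∃ BM : ℝ, BM = κ₁ * (1 + Real.exp δ₅) * ((d + 1) * (κ₁ * cs + cT))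
        + (κ₂ + (aj + a) * ((ℓ : ℝ) + 1) * Real.exp (δ₅ * ((ℓ : ℝ) + 1)) * κ₁) * (κ₁ * c' + cL) := ⟨_, rfl⟩
    have hBM0 : 0 ≤ BM := by rw [hBM]; positivity
    have hBMle : BM ≤ CΨ₀ / M := by
      have hκ₂' : κ₂ ≤ A₂ / M := by
        rw [hκ₂, hA₂]
        have hM2 : D2 hprof / M ^ 2 ≤ D2 hprof / M := by
          apply div_le_div_of_nonneg_left hD2 hMpos
          calc M = M * 1 := (mul_one M).symm
            _ ≤ M * M := mul_le_mul_of_nonneg_left hM1 hMpos.le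
            _ = M ^ 2 := (sq M).symm
        calc ((d : ℝ) + 1) * (D2 hprof / M ^ 2) ≤ (d + 1) * (D2 hprof / M) :=
              mul_le_mul_of_nonneg_left hM2 (by positivity)
          _ = (d + 1) * D2 hprof / M := mul_div_assoc' _ _ _
      have hajp : (aj + a) * ((ℓ : ℝ) + 1) * Real.exp (δ₅ * ((ℓ : ℝ) + 1)) ≤ ap := by
        rw [hap]
        have : aj + a ≤ |aplus| + |a2plus| := add_le_add (e2.trans (le_abs_self _)) (e6.trans (le_abs_self _))
        exact mul_le_mul_of_nonneg_right (mul_le_mul_of_nonneg_right this hL0) (Real.exp_pos _).le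
      have h1 : κ₁ * (1 + Real.exp δ₅) * ((d + 1) * (κ₁ * cs + cT))
          ≤ (A₁ / M) * (1 + Real.exp δ₅) * ((d + 1) * (A₁ * cs + cT)) := by
        rw [hκ₁]
        refine mul_le_mul_of_nonneg_left (mul_le_mul_of_nonneg_left (add_le_add
          (mul_le_mul_of_nonneg_right (hκ₁ ▸ hκ₁A) hcs.le) le_rfl) (by positivity)) (by positivity)
      have h2 : (κ₂ + (aj + a) * ((ℓ : ℝ) + 1) * Real.exp (δ₅ * ((ℓ : ℝ) + 1)) * κ₁) * (κ₁ * c' + cL)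
          ≤ (A₂ / M + ap * (A₁ / M)) * (A₁ * c' + cL) := by
        refine mul_le_mul (add_le_add hκ₂' ?_) (add_le_add (mul_le_mul_of_nonneg_right hκ₁A hc'.le) le_rfl)
          (by positivity) (by positivity)
        rw [hκ₁]; exact mul_le_mul_of_nonneg_right hajp (by positivity)
      have h3 : (A₁ / M) * (1 + Real.exp δ₅) * ((d + 1) * (A₁ * cs + cT)) + (A₂ / M + ap * (A₁ / M)) * (A₁ * c' + cL)
          = CΨ₀ / M := by rw [hCΨ₀]; field_simp
      rw [hBM, ← h3]
      exact add_le_add h1 h2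
    -- per-cube: either no `h_q` at both points (the term vanishes) or both points lie in the cube
    have hterm : ∀ q : ↥(ctrs P),
        wsum2 δ₅ ((ℓ + 1) ^ k) x x' (fun y => W * ((bPad ℓ k Mh P aj a m2 Λ hP q)ᵀ x' y
          - (bPad ℓ k Mh P aj a m2 Λ hP q)ᵀ x y)) ≤ BM
        ∧ ((hΩ ℓ k Mh P q.1 x = 0 ∧ hΩ ℓ k Mh P q.1 x' = 0) →
          wsum2 δ₅ ((ℓ + 1) ^ k) x x' (fun y => W * ((bPad ℓ k Mh P aj a m2 Λ hP q)ᵀ x' y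
            - (bPad ℓ k Mh P aj a m2 Λ hP q)ᵀ x y)) = 0) := by
      intro q
      have hzero : (hΩ ℓ k Mh P q.1 x = 0 ∧ hΩ ℓ k Mh P q.1 x' = 0) →
          wsum2 δ₅ ((ℓ + 1) ^ k) x x' (fun y => W * ((bPad ℓ k Mh P aj a m2 Λ hP q)ᵀ x' y
            - (bPad ℓ k Mh P aj a m2 Λ hP q)ᵀ x y)) = 0 := by
        rintro ⟨h0, h0'⟩
        unfold wsum2
        refine Finset.sum_eq_zero fun y _ => ?_
        simp only
        rw [bPad_transpose_row_eq_zero hMh1 hP q h0, bPad_transpose_row_eq_zero hMh1 hP q h0', sub_self, mul_zero,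
          abs_zero, zero_mul]
      refine ⟨?_, hzero⟩
      by_cases hboth : hΩ ℓ k Mh P q.1 x = 0 ∧ hΩ ℓ k Mh P q.1 x' = 0
      · rw [hzero hboth]; exact hBM0
      · -- both points lie in the cube `□_q`
        have hxx' : supNorm (x'.1 - x.1) ≤ 2 * (((ℓ + 1) ^ k : ℕ) : ℝ) := by linarith
        have hx'x : supNorm (x.1 - x'.1) ≤ 2 * (((ℓ + 1) ^ k : ℕ) : ℝ) := by
          rw [← neg_sub, B4TorusKernel.supNorm_neg]; exact hxx'
        obtain ⟨b, b', hb, hb'⟩ : ∃ b b' : ↥(Box d ℓ k (fun i => (ℓ + 1) * cubeM' Mh P q.1 i)),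
            emb ℓ k Mh P q.1 hP q.2 b = x ∧ emb ℓ k Mh P q.1 hP q.2 b' = x' := by
          rw [not_and_or] at hboth
          rcases hboth with h0 | h0
          · obtain ⟨b, hb⟩ := exists_emb_eq_of_near hℓ hk hMh hP q.2 h0 (p := x) (by
              rw [sub_self]; simp [B4ContourShift.supNorm]; positivity)
            obtain ⟨b', hb'⟩ := exists_emb_eq_of_near hℓ hk hMh hP q.2 h0 hxx'
            exact ⟨b, b', hb, hb'⟩
          · obtain ⟨b', hb'⟩ := exists_emb_eq_of_near hℓ hk hMh hP q.2 h0 (p := x') (by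
              rw [sub_self]; simp [B4ContourShift.supNorm]; positivity)
            obtain ⟨b, hb⟩ := exists_emb_eq_of_near hℓ hk hMh hP q.2 h0 hx'x
            exact ⟨b, b', hb, hb'⟩
        subst hb hb'
        have hbb : b'.1 - b.1 = (emb ℓ k Mh P q.1 hP q.2 b').1 - (emb ℓ k Mh P q.1 hP q.2 b).1 :=
          (emb_sub_emb hP q.2 b' b).symm
        have hneb : b'.1 ≠ b.1 := fun h => hne (by
          have := emb_sub_emb hP q.2 b' b; rw [h, sub_self] at this; exact (sub_eq_zero.1 this))
        have hnearb : supNorm (b'.1 - b.1) ≤ (((ℓ + 1) ^ k : ℕ) : ℝ) := by rw [hbb]; exact hnear.le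
        rw [hW, ← hbb, hBM, hcL]
        refine wsum2_transpose_bPad_pair_le hℓ hMh1 hP haj ha0 hΛ q hδ₅0.le hc'.le hcd.le hκ₁0 hκ₂0
          (fun p => (roww_mono hδ₅a _ _ _).trans
            (h243 k hk aj m2 a e1 e2 e3 e4 e5 e6 (cubeM' Mh P q.1) (hM' q) (lamLoc ℓ Mh P q.1 hP q.2 Λ) p))
          (fun i v ve hve => (wsum_mono hδ₅d _ _ _).trans (by
            have := h243d k hk aj m2 a e1 e2 e3 e4 e5 e6 (cubeM' Mh P q.1) (hM' q) (lamLoc ℓ Mh P q.1 hP q.2 Λ) i v ve hve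
            unfold wsum; exact this))
          (fun μ p => (roww_mono hδ₅b _ _ _).trans
            (h243s k hk aj m2 a e1 e2 e3 e4 e5 e6 (cubeM' Mh P q.1) (hM' q) (lamLoc ℓ Mh P q.1 hP q.2 Λ) μ p))
          (fun z z' => ?_) (fun z => ?_) hα0 hα1.le b b' hneb hnearb (fun μ => ?_)
        · rw [hκ₁, hA₁, hM]; exact hLoc_lipschitz hMh1 q.1 z z'
        · rw [hκ₂, hM]; exact hLoc_laplacian_le hℓ hk hMh1 hP q.2 z
        · refine (wsum2_mono_rate hδ₅T _ _ _ _).trans ?_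
          have := h243T k hk aj m2 a e1 e2 e3 e4 e5 e6 (cubeM' Mh P q.1) (hM' q) (lamLoc ℓ Mh P q.1 hP q.2 Λ) μ b b' hneb
          unfold wsum2; exact this
    -- `Rᵀ = Σ_q (bPad q)ᵀ` and the overlap count
    have hb : ∀ q : ↥(ctrs P), B6Eq250.bTerm (twoLevelOp ((ℓ + 1) ^ k) ℓ aj a m2 (fun i => Mh * P i) Λ)
        (hDiag ℓ k Mh P) (gPad ℓ k Mh P aj a m2 Λ hP) q = bPad ℓ k Mh P aj a m2 Λ hP q := fun q => by
      rw [B6Eq250.bTerm_apply]; exact bTerm_eq_bPad hℓ hk hMh1 hΛ q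
    have hfun : (fun y => W * (Rt x' y - Rt x y))
        = fun y => ∑ q : ↥(ctrs P), W * ((bPad ℓ k Mh P aj a m2 Λ hP q)ᵀ x' y - (bPad ℓ k Mh P aj a m2 Λ hP q)ᵀ x y) := by
      funext y
      rw [hRt, B6Eq250.rOp_eq_sum_bTerm, Matrix.transpose_sum]
      simp_rw [hb]
      simp only [Matrix.sum_apply]
      rw [← Finset.sum_sub_distrib, Finset.mul_sum]
    rw [hfun]
    refine (wsum2_sum_le _ _ _ x x' _).trans ?_
    have key := sum_le_card_mul'
      (fun q : ↥(ctrs P) => wsum2 δ₅ ((ℓ + 1) ^ k) x x' (fun y => W * ((bPad ℓ k Mh P aj a m2 Λ hP q)ᵀ x' y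
          - (bPad ℓ k Mh P aj a m2 Λ hP q)ᵀ x y)))
      (fun q => q.1) Subtype.val_injective
      (near ((ℓ + 1) ^ k * ((ℓ + 1) * Mh)) x.1 ∪ near ((ℓ + 1) ^ k * ((ℓ + 1) * Mh)) x'.1)
      (fun q hq0 => by
        have hor : hΩ ℓ k Mh P q.1 x ≠ 0 ∨ hΩ ℓ k Mh P q.1 x' ≠ 0 := by
          by_contra hh
          push Not at hh
          exact hq0 ((hterm q).2 hh)
        have hNr : (0 : ℝ) < (((ℓ + 1) ^ k * ((ℓ + 1) * Mh) : ℕ) : ℝ) := by exact_mod_cast hN1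
        rcases hor with h0 | h0
        · exact Finset.mem_union_left _ (mem_near_of_abs_lt hN1 fun ν =>
            (abs_lt_of_hq_ne_zero hN1 h0 ν).trans (by nlinarith))
        · exact Finset.mem_union_right _ (mem_near_of_abs_lt hN1 fun ν =>
            (abs_lt_of_hq_ne_zero hN1 h0 ν).trans (by nlinarith)))
      hBM0 (fun q => (hterm q).1)
    refine key.trans ?_
    have hcard : (((near ((ℓ + 1) ^ k * ((ℓ + 1) * Mh)) x.1 ∪ near ((ℓ + 1) ^ k * ((ℓ + 1) * Mh)) x'.1).card : ℕ) : ℝ)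
        ≤ 2 * 2 ^ (d + 1) := by
      have h1 := Finset.card_union_le (near ((ℓ + 1) ^ k * ((ℓ + 1) * Mh)) x.1)
        (near ((ℓ + 1) ^ k * ((ℓ + 1) * Mh)) x'.1)
      have h2 := card_near_le ((ℓ + 1) ^ k * ((ℓ + 1) * Mh)) x.1
      have h3 := card_near_le ((ℓ + 1) ^ k * ((ℓ + 1) * Mh)) x'.1
      have : (near ((ℓ + 1) ^ k * ((ℓ + 1) * Mh)) x.1 ∪ near ((ℓ + 1) ^ k * ((ℓ + 1) * Mh)) x'.1).card
          ≤ 2 * 2 ^ (d + 1) := by omega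
      exact_mod_cast this
    calc (((near ((ℓ + 1) ^ k * ((ℓ + 1) * Mh)) x.1 ∪ near ((ℓ + 1) ^ k * ((ℓ + 1) * Mh)) x'.1).card : ℕ) : ℝ) * BM
        ≤ (2 * 2 ^ (d + 1)) * BM := mul_le_mul_of_nonneg_right hcard hBM0
      _ ≤ (2 * 2 ^ (d + 1)) * (CΨ₀ / M) := mul_le_mul_of_nonneg_left hBMle (by positivity)
      _ = (2 * 2 ^ (d + 1) * CΨ₀) / M := (mul_div_assoc _ _ _).symm
      _ ≤ (2 * CR + 2 * 2 ^ (d + 1) * CΨ₀ + 1) / M := by gcongr; linarith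

end ColumnPairAssembly

/-! ## §4 The (2.64)-input for the row PAIRS of `dstar G′₀` (`G′₀ = Σ_q h_qG′(□_q)h_q`) -/

section GZeroPair

variable {ℓ k Mh : ℕ} {P : Fin (d + 1) → ℕ}

open Literature.MathematicalPhysics.QuantumFieldTheory.Balaban1983to89.B4PartitionUnity22 (D1 D1_nonneg
  hprof contDiff_hprof hasCompactSupport_hprof)
open Literature.MathematicalPhysics.QuantumFieldTheory.Balaban1983to89.B6Eq238TwoLevelBox
open Literature.MathematicalPhysics.QuantumFieldTheory.Balaban1983to89.B6Partition236TwoLevelBox (ctrs hq abs_hq_le_one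
  abs_hq_sub_le abs_lt_of_hq_ne_zero one_le_cubeW)
open Literature.MathematicalPhysics.QuantumFieldTheory.Balaban1983to89.B6Ineq249TwoLevelBox (near card_near_le
  mem_near_of_abs_lt emb_sub_emb)
open Literature.MathematicalPhysics.QuantumFieldTheory.Balaban1983to89.B6Ineq243AdjTwoLevelBox (ineq243_twoLevel_dstar_roww
  dstar_sum)
open Literature.MathematicalPhysics.QuantumFieldTheory.Balaban1983to89.B6Prop22AdjTwoLevelBox (hLoc_lipschitz
  roww_dstar_gZero_le pad_apply_emb pad_apply_row_off pad_apply_col_off exists_emb_pair_of_hΩ_fwd_ne_zero)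
open Literature.MathematicalPhysics.QuantumFieldTheory.Balaban1983to89.B6Prop22HolderTwoLevelBox (exists_emb_eq_of_near)
open Literature.MathematicalPhysics.QuantumFieldTheory.Balaban1983to89.B6Ineq243HolderDualTwoLevelBox
  (ineq243_twoLevel_holderDual_wsum2)

variable {N : Fin (d + 1) → ℕ} in
/-- `wsum2` of a finite sum of functions is at most the sum of the `wsum2`. [folklore] -/
private theorem wsum2_sum_le' {ι : Type*} (s : Finset ι) (δ : ℝ) (n : ℕ) (x x' : ↥(boxDom N))
    (g : ι → ↥(boxDom N) → ℝ) : wsum2 δ n x x' (fun z => ∑ i ∈ s, g i z) ≤ ∑ i ∈ s, wsum2 δ n x x' (g i) := by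
  classical
  induction s using Finset.induction_on with
  | empty =>
      simp only [Finset.sum_empty]
      unfold wsum2
      simp
  | insert i s hi ih =>
      rw [Finset.sum_insert hi]
      have e : (fun z => ∑ j ∈ insert i s, g j z) = fun z => g i z + ∑ j ∈ s, g j z :=
        funext fun z => Finset.sum_insert hi
      rw [e]
      exact (wsum2_add_le _ _ _ _ _ _).trans (add_le_add le_rfl ih)

variable {N : Fin (d + 1) → ℕ} in
/-- comparison: `|g| ≤ c|g′|` pointwise gives `wsum2(g) ≤ c·wsum2(g′)`. [folklore] -/
private theorem wsum2_le_mul_of_abs_le' (δ : ℝ) (n : ℕ) (x x' : ↥(boxDom N)) {g g' : ↥(boxDom N) → ℝ} {c : ℝ}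
    (h : ∀ z, |g z| ≤ c * |g' z|) : wsum2 δ n x x' g ≤ c * wsum2 δ n x x' g' := by
  unfold wsum2
  rw [Finset.mul_sum]
  refine Finset.sum_le_sum fun z _ => ?_
  have := mul_le_mul_of_nonneg_right (h z) (Real.exp_pos
    (δ * min (supNorm (x.1 - z.1)) (supNorm (x'.1 - z.1)) / n)).le
  linarith [this]

variable {N : Fin (d + 1) → ℕ} in
/-- a sum of non-negative terms, each `≤ B`, non-zero only on terms indexed injectively by `T`: `≤ |T|·B`. [folklore] -/
private theorem sum_le_card_mul'' {ι σ : Type*} [Fintype ι] [DecidableEq σ] (f : ι → ℝ) (key : ι → σ)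
    (hkey : Function.Injective key) (T : Finset σ) (hT : ∀ i, f i ≠ 0 → key i ∈ T) {B : ℝ} (hB : 0 ≤ B)
    (hf : ∀ i, f i ≤ B) : ∑ i, f i ≤ T.card * B := by
  classical
  rw [← Finset.sum_filter_ne_zero]
  have hcard : (Finset.univ.filter fun i => f i ≠ 0).card ≤ T.card :=
    Finset.card_le_card_of_injOn key (fun i hi => by
      rw [Finset.coe_filter] at hi; exact hT i hi.2) (fun i _ j _ h => hkey h)
  calc ∑ i ∈ Finset.univ.filter (fun i => f i ≠ 0), f i
      ≤ (Finset.univ.filter fun i => f i ≠ 0).card • B := Finset.sum_le_card_nsmul _ _ _ fun i _ => hf i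
    _ = ((Finset.univ.filter fun i => f i ≠ 0).card : ℝ) * B := by rw [nsmul_eq_mul]
    _ ≤ T.card * B := by gcongr

/-- **ONE TERM OF `dstar G′₀`, TWO ROWS**: for two sites `b ≠ b′` of the cube `□_q` within the mesh of each other, the
Hölder-weighted two-centre functional of the difference of the rows `emb b′`, `emb b` of `dstar(h_qG′(□_q)h_q)` (padded)
is at most `(κ₁c_s + c_T) + κ(κ₁c′ + 2c′ + (d+1)e^{δ}c_d)` — the product rule in the bond variable
`ξ^{−1}((ũh)(fwd z) − (ũh)(z)) = ξ^{−1}(ũ(fwd z) − ũ(z))h(fwd z) + ũ(z)ξ^{−1}(h(fwd z) − h(z))` for the two-row vector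
`ũ = h(b′)Ĝ(b′,·) − h(b)Ĝ(b,·)`, `|ξ^{−1}∂h| ≤ κ`, and §2.
[cite: Balaban1984PropagatorsII, (2.64) p.234 (the `G′∇*` clause of (2.67)), (2.43) p.230] -/
theorem wsum2_dstar_aTerm_pair_le (hℓ : 1 ≤ ℓ) (hk : 1 ≤ k) (hMh : 1 ≤ Mh) (hP : ∀ i, 1 ≤ P i) {aj a m2 : ℝ}
    {Λ : Finset ↥(boxDom (fun i => (ℓ + 1) * (Mh * P i)))} (q : ↥(ctrs P)) (μ : Fin (d + 1))
    {δ c' cd cs cT κ₁ κ : ℝ} (hδ : 0 ≤ δ) (hc' : 0 ≤ c') (hcd : 0 ≤ cd) (hκ₁ : 0 ≤ κ₁) (hκ : 0 ≤ κ)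
    (hG : ∀ b, roww δ ((ℓ + 1) ^ k) (cubeG ℓ k Mh P aj a m2 Λ hP q) b ≤ c')
    (hGd : ∀ (i : Fin (d + 1)) (v ve : ↥(Box d ℓ k (fun i => (ℓ + 1) * cubeM' Mh P q.1 i))),
      ve.1 = v.1 + Pi.single i 1 →
      wsum δ ((ℓ + 1) ^ k) v (fun c => (((ℓ + 1) ^ k : ℕ) : ℝ) *
        (cubeG ℓ k Mh P aj a m2 Λ hP q ve c - cubeG ℓ k Mh P aj a m2 Λ hP q v c)) ≤ cd)
    (hGs : ∀ b, roww δ ((ℓ + 1) ^ k) (dstar ((ℓ + 1) ^ k) μ (cubeG ℓ k Mh P aj a m2 Λ hP q)) b ≤ cs)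
    (hLip : ∀ z z' : ↥(Box d ℓ k (fun i => (ℓ + 1) * cubeM' Mh P q.1 i)),
      |hLoc ℓ k Mh P q.1 z' - hLoc ℓ k Mh P q.1 z| ≤ κ₁ * supNorm (z'.1 - z.1) / (((ℓ + 1) ^ k : ℕ) : ℝ))
    (hdh : ∀ z : ↥(Box d ℓ k (fun i => (ℓ + 1) * (Mh * P i))),
      |((((ℓ + 1) ^ k : ℕ)) : ℝ) * (hΩ ℓ k Mh P q.1 (fwd _ μ z) - hΩ ℓ k Mh P q.1 z)| ≤ κ)
    {α : ℝ} (hα0 : 0 ≤ α) (hα1 : α ≤ 1)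
    (b b' : ↥(Box d ℓ k (fun i => (ℓ + 1) * cubeM' Mh P q.1 i))) (hne : b'.1 ≠ b.1)
    (hnear : supNorm (b'.1 - b.1) ≤ (((ℓ + 1) ^ k : ℕ) : ℝ))
    (hT : wsum2 δ ((ℓ + 1) ^ k) b b' (fun w => ((((ℓ + 1) ^ k : ℕ) : ℝ) / supNorm (b'.1 - b.1)) ^ α *
      ((((ℓ + 1) ^ k : ℕ) : ℝ) * ((cubeG ℓ k Mh P aj a m2 Λ hP q b' (fwd _ μ w) - cubeG ℓ k Mh P aj a m2 Λ hP q b' w)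
        - (cubeG ℓ k Mh P aj a m2 Λ hP q b (fwd _ μ w) - cubeG ℓ k Mh P aj a m2 Λ hP q b w)))) ≤ cT) :
    wsum2 δ ((ℓ + 1) ^ k) (emb ℓ k Mh P q.1 hP q.2 b) (emb ℓ k Mh P q.1 hP q.2 b') (fun z =>
        ((((ℓ + 1) ^ k : ℕ) : ℝ) / supNorm (b'.1 - b.1)) ^ α *
          (dstar ((ℓ + 1) ^ k) μ (B6Eq250.aTerm (hDiag ℓ k Mh P) (gPad ℓ k Mh P aj a m2 Λ hP) q)
              (emb ℓ k Mh P q.1 hP q.2 b') z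
            - dstar ((ℓ + 1) ^ k) μ (B6Eq250.aTerm (hDiag ℓ k Mh P) (gPad ℓ k Mh P aj a m2 Λ hP) q)
              (emb ℓ k Mh P q.1 hP q.2 b) z))
      ≤ (κ₁ * cs + cT) + κ * (κ₁ * c' + (2 * c' + ((d : ℝ) + 1) * Real.exp δ * cd)) := by
  have hn1 : 1 ≤ (ℓ + 1) ^ k := Nat.one_le_pow _ _ (by omega)
  have hinj := emb_injective (ℓ := ℓ) (k := k) (Mh := Mh) hP q.2
  set n : ℕ := (ℓ + 1) ^ k with hn
  set W : ℝ := (((n : ℕ) : ℝ) / supNorm (b'.1 - b.1)) ^ α with hW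
  set h := hΩ ℓ k Mh P q.1 with hh
  set Pq := gPad ℓ k Mh P aj a m2 Λ hP q with hPq
  set x := emb ℓ k Mh P q.1 hP q.2 b with hx
  set x' := emb ℓ k Mh P q.1 hP q.2 b' with hx'
  have hcT : 0 ≤ cT := (wsum2_nonneg _ _ _ _ _).trans hT
  -- the cut-off at the two rows
  have hxh : h x = hLoc ℓ k Mh P q.1 b := by rw [hh, hx]; exact hΩ_emb hMh hP q.2 b
  have hx'h : h x' = hLoc ℓ k Mh P q.1 b' := by rw [hh, hx']; exact hΩ_emb hMh hP q.2 b'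
  have ht : |hLoc ℓ k Mh P q.1 b| ≤ 1 := by rw [← hxh]; exact abs_hq_le_one _ _ _ _
  have htt : |hLoc ℓ k Mh P q.1 b' - hLoc ℓ k Mh P q.1 b| ≤ κ₁ * supNorm (b'.1 - b.1) / ((n : ℕ) : ℝ) := hLip b b'
  -- the padded two-row vector and the cube vector
  set up : ↥(Box d ℓ k (fun i => (ℓ + 1) * (Mh * P i))) → ℝ := fun z => W * (h x' * Pq x' z - h x * Pq x z) with hup
  set u : ↥(Box d ℓ k (fun i => (ℓ + 1) * cubeM' Mh P q.1 i)) → ℝ := fun w =>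
    W * (hLoc ℓ k Mh P q.1 b' * cubeG ℓ k Mh P aj a m2 Λ hP q b' w
      - hLoc ℓ k Mh P q.1 b * cubeG ℓ k Mh P aj a m2 Λ hP q b w) with hu
  have hup_emb : ∀ c, up (emb ℓ k Mh P q.1 hP q.2 c) = u c := by
    intro c
    rw [hup, hu]; simp only
    rw [hx'h, hxh, hPq]
    unfold gPad
    rw [hx', hx, pad_apply_emb hP q.2, pad_apply_emb hP q.2]
  have hup_off : ∀ z, (∀ c, emb ℓ k Mh P q.1 hP q.2 c ≠ z) → up z = 0 := by
    intro z hz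
    rw [hup]; simp only
    rw [hPq]; unfold gPad
    rw [pad_apply_col_off hP q.2 _ _ hz, pad_apply_col_off hP q.2 _ _ hz]; ring
  -- the entries: product rule in the bond variable
  have hent : ∀ z, W * (dstar n μ (B6Eq250.aTerm (hDiag ℓ k Mh P) (gPad ℓ k Mh P aj a m2 Λ hP) q) x' z
        - dstar n μ (B6Eq250.aTerm (hDiag ℓ k Mh P) (gPad ℓ k Mh P aj a m2 Λ hP) q) x z)
      = ((n : ℕ) : ℝ) * (up (fwd _ μ z) - up z) * h (fwd _ μ z)
        + up z * (((n : ℕ) : ℝ) * (h (fwd _ μ z) - h z)) := by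
    intro z
    rw [B6Eq250.aTerm_apply]
    unfold hDiag
    rw [← hh, ← hPq, dstar_apply, dstar_apply]
    simp only [Matrix.mul_diagonal, Matrix.diagonal_mul, hup]
    ring
  have hfun : (fun z => W * (dstar n μ (B6Eq250.aTerm (hDiag ℓ k Mh P) (gPad ℓ k Mh P aj a m2 Λ hP) q) x' z
        - dstar n μ (B6Eq250.aTerm (hDiag ℓ k Mh P) (gPad ℓ k Mh P aj a m2 Λ hP) q) x z))
      = fun z => ((n : ℕ) : ℝ) * (up (fwd _ μ z) - up z) * h (fwd _ μ z)
        + up z * (((n : ℕ) : ℝ) * (h (fwd _ μ z) - h z)) := funext hent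
  rw [hfun]
  refine (wsum2_add_le _ _ _ _ _ _).trans (add_le_add ?_ ?_)
  · -- the differenced two-row vector against `h(fwd z)`: the cube functional of §2
    have hUd : wsum2 δ n b b' (fun w => ((n : ℕ) : ℝ) * (u (fwd _ μ w) - u w)) ≤ κ₁ * cs + cT := by
      have := cube_pair_diff_wsum2_le hδ hn1 (cubeG ℓ k Mh P aj a m2 Λ hP q) μ hGs hα1 b b' hne hnear hT hκ₁ ht htt
      rw [hu]
      exact this
    refine le_trans ?_ hUd
    unfold wsum2
    -- the summand vanishes off the image of `emb`
    have hoff : ∀ z, (∀ c, emb ℓ k Mh P q.1 hP q.2 c ≠ z) →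
        |((n : ℕ) : ℝ) * (up (fwd _ μ z) - up z) * h (fwd _ μ z)|
          * Real.exp (δ * min (supNorm (x.1 - z.1)) (supNorm (x'.1 - z.1)) / n) = 0 := by
      intro z hz
      by_cases h1 : h (fwd _ μ z) = 0
      · rw [h1, mul_zero, abs_zero, zero_mul]
      · rcases fwd_spec μ z with e | e
        · obtain ⟨c, -, hc, -, -⟩ := exists_emb_pair_of_hΩ_fwd_ne_zero hℓ hk hMh hP q.2 e h1
          exact absurd hc (hz c)
        · rw [e, sub_self, mul_zero, zero_mul, abs_zero, zero_mul]
    rw [sum_eq_sum_image' hinj _ hoff]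
    refine Finset.sum_le_sum fun c _ => ?_
    rw [emb_sub_emb hP q.2, emb_sub_emb hP q.2]
    refine mul_le_mul_of_nonneg_right ?_ (Real.exp_pos _).le
    by_cases h0 : h (fwd _ μ (emb ℓ k Mh P q.1 hP q.2 c)) = 0
    · rw [h0, mul_zero, abs_zero]; exact abs_nonneg _
    rcases fwd_spec μ (emb ℓ k Mh P q.1 hP q.2 c) with e | e
    · obtain ⟨c₀, ce, hc₀, hce, hstep⟩ := exists_emb_pair_of_hΩ_fwd_ne_zero hℓ hk hMh hP q.2 e h0
      have : c₀ = c := hinj hc₀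
      subst this
      have hfc : fwd _ μ c₀ = ce := fwd_eq_of_nbr μ c₀ ce hstep
      simp only
      rw [← hce, hfc, hup_emb, hup_emb, abs_mul]
      exact mul_le_of_le_one_right (abs_nonneg _) (by rw [hce]; exact abs_hq_le_one _ _ _ _)
    · rw [e, sub_self, mul_zero, zero_mul, abs_zero]; exact abs_nonneg _
  · -- the two-row vector against `ξ^{−1}∂h`
    have hU : wsum2 δ n b b' u ≤ κ₁ * c' + (2 * c' + ((d : ℝ) + 1) * Real.exp δ * cd) :=
      cube_pair_wsum2_le hδ hn1 _ hc' hcd hG hGd hα0 hα1 b b' hne hnear hκ₁ ht htt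
    have hcmp : wsum2 δ n x x' (fun z => up z * (((n : ℕ) : ℝ) * (h (fwd _ μ z) - h z)))
        ≤ κ * wsum2 δ n x x' up := by
      refine wsum2_le_mul_of_abs_le' _ _ x x' fun z => ?_
      rw [abs_mul, mul_comm]
      exact mul_le_mul_of_nonneg_right (hdh z) (abs_nonneg _)
    refine hcmp.trans (mul_le_mul_of_nonneg_left ?_ hκ)
    -- the padded two-row vector is the cube vector
    have hpad : wsum2 δ n x x' up = wsum2 δ n b b' u := by
      unfold wsum2
      have hoff : ∀ z, (∀ c, emb ℓ k Mh P q.1 hP q.2 c ≠ z) →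
          |up z| * Real.exp (δ * min (supNorm (x.1 - z.1)) (supNorm (x'.1 - z.1)) / n) = 0 := by
        intro z hz; rw [hup_off z hz, abs_zero, zero_mul]
      rw [sum_eq_sum_image' hinj _ hoff]
      refine Finset.sum_congr rfl fun c _ => ?_
      rw [hup_emb, hx, hx', emb_sub_emb hP q.2, emb_sub_emb hP q.2]
    rw [hpad]
    exact hU

end GZeroPair

section GZeroPairAssembly

variable {ℓ k Mh : ℕ} {P : Fin (d + 1) → ℕ}

open Literature.MathematicalPhysics.QuantumFieldTheory.Balaban1983to89.B4PartitionUnity22 (D1 D1_nonneg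
  hprof contDiff_hprof hasCompactSupport_hprof)
open Literature.MathematicalPhysics.QuantumFieldTheory.Balaban1983to89.B6Eq238TwoLevelBox
open Literature.MathematicalPhysics.QuantumFieldTheory.Balaban1983to89.B6Partition236TwoLevelBox (ctrs hq abs_hq_le_one
  abs_hq_sub_le abs_lt_of_hq_ne_zero one_le_cubeW)
open Literature.MathematicalPhysics.QuantumFieldTheory.Balaban1983to89.B6Ineq249TwoLevelBox (near card_near_le
  mem_near_of_abs_lt emb_sub_emb)
open Literature.MathematicalPhysics.QuantumFieldTheory.Balaban1983to89.B6Ineq243AdjTwoLevelBox (ineq243_twoLevel_dstar_roww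
  dstar_sum)
open Literature.MathematicalPhysics.QuantumFieldTheory.Balaban1983to89.B6Prop22AdjTwoLevelBox (hLoc_lipschitz
  roww_dstar_gZero_le)
open Literature.MathematicalPhysics.QuantumFieldTheory.Balaban1983to89.B6Prop22HolderTwoLevelBox (exists_emb_eq_of_near)
open Literature.MathematicalPhysics.QuantumFieldTheory.Balaban1983to89.B6Ineq243HolderDualTwoLevelBox
  (ineq243_twoLevel_holderDual_wsum2)

/-- a row of `h_qG′(□_q)h_q` (padded) at a site not carrying `h_q` vanishes, and so does its `dstar`.
[cite: Balaban1984PropagatorsII, (2.37) p.229, dictionary] -/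
theorem dstar_aTerm_row_eq_zero (n : ℕ) (μ : Fin (d + 1)) {aj a m2 : ℝ} (hP : ∀ i, 1 ≤ P i)
    {Λ : Finset ↥(boxDom (fun i => (ℓ + 1) * (Mh * P i)))} (q : ↥(ctrs P))
    {x : ↥(Box d ℓ k (fun i => (ℓ + 1) * (Mh * P i)))} (hx : hΩ ℓ k Mh P q.1 x = 0)
    (z : ↥(Box d ℓ k (fun i => (ℓ + 1) * (Mh * P i)))) :
    dstar n μ (B6Eq250.aTerm (hDiag ℓ k Mh P) (gPad ℓ k Mh P aj a m2 Λ hP) q) x z = 0 := by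
  rw [dstar_apply, B6Eq250.aTerm_apply]
  unfold hDiag
  simp only [Matrix.mul_diagonal, Matrix.diagonal_mul, hx, zero_mul, sub_self, mul_zero]

set_option maxHeartbeats 1600000 in
/-- **THE (2.64)-INPUT FOR THE ROW PAIRS OF `dstar G′₀`**: for `0 ≤ α < 1` there are `δ₆, C₆ > 0` (functions of `d`, `ℓ`,
`α`, the windows) such that for EVERY mesh `k ≥ 1`, `M_h ≥ 3`, volume, `Λ`, window point, axis `μ` and all `x ≠ x′`:
`Σ_z (n/|x′−x|_∞)^α·|dstar G′₀(x′,z) − dstar G′₀(x,z)|·e^{δ₆min(|x−z|,|x′−z|)/n} ≤ C₆` — far pairs by the two rows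
(`B6Prop22AdjTwoLevelBox.roww_dstar_gZero_le`), near pairs cube by cube (`wsum2_dstar_aTerm_pair_le`, at most `2·2^{d+1}`
cubes). [cite: Balaban1984PropagatorsII, (2.64) p.234 (the `G′∇*` Hölder clause of (2.67)), (2.43) p.230] -/
theorem wsum2_dstar_gZero_pair_le (d ℓ : ℕ) (hℓ : 1 ≤ ℓ) (aminus aplus m2plus a2minus a2plus : ℝ) (ha : 0 < aminus)
    (ha2 : 0 < a2minus) (α : ℝ) (hα0 : 0 ≤ α) (hα1 : α < 1) :
    ∃ δ₆ C₆ : ℝ, 0 < δ₆ ∧ 0 < C₆ ∧ ∀ (k : ℕ), 1 ≤ k → ∀ (aj m2 a : ℝ), aminus ≤ aj → aj ≤ aplus → 0 ≤ m2 →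
      m2 ≤ m2plus → a2minus ≤ a → a ≤ a2plus → ∀ (Mh : ℕ), 3 ≤ Mh → ∀ (P : Fin (d + 1) → ℕ) (hP : ∀ i, 1 ≤ P i)
        (Λ : Finset ↥(boxDom (fun i => (ℓ + 1) * (Mh * P i)))) (μ : Fin (d + 1))
        (x x' : ↥(Box d ℓ k (fun i => (ℓ + 1) * (Mh * P i)))), x'.1 ≠ x.1 →
          wsum2 δ₆ ((ℓ + 1) ^ k) x x' (fun z => ((((ℓ + 1) ^ k : ℕ) : ℝ) / supNorm (x'.1 - x.1)) ^ α *
            (dstar ((ℓ + 1) ^ k) μ (B6Eq250.gZero (hDiag ℓ k Mh P) (gPad ℓ k Mh P aj a m2 Λ hP)) x' z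
              - dstar ((ℓ + 1) ^ k) μ (B6Eq250.gZero (hDiag ℓ k Mh P) (gPad ℓ k Mh P aj a m2 Λ hP)) x z)) ≤ C₆ := by
  obtain ⟨δa, c', hδa, hc', h243⟩ := ineq243_twoLevel_roww d ℓ hℓ aminus aplus m2plus a2minus a2plus ha ha2
  obtain ⟨δd, cd, hδd, hcd, h243d⟩ := ineq243_twoLevel_deriv_wsum d ℓ hℓ aminus aplus m2plus a2minus a2plus ha ha2
  obtain ⟨δb, cs, hδb, hcs, h243s⟩ := ineq243_twoLevel_dstar_roww d ℓ hℓ aminus aplus m2plus a2minus a2plus ha ha2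
  obtain ⟨δT, cT, hδT, hcT, h243T⟩ :=
    ineq243_twoLevel_holderDual_wsum2 d ℓ hℓ aminus aplus m2plus a2minus a2plus ha ha2 α hα0 hα1
  obtain ⟨δ₂, C₀, hδ₂, hC₀, hG0⟩ := roww_dstar_gZero_le d ℓ hℓ aminus aplus m2plus a2minus a2plus ha ha2
  have hD1 := D1_nonneg contDiff_hprof hasCompactSupport_hprof
  obtain ⟨δ₆, hδ₆⟩ : ∃ δ₆ : ℝ, δ₆ = min (min (min δa δd) (min δb δT)) δ₂ := ⟨_, rfl⟩
  have hδ₆0 : 0 < δ₆ := by rw [hδ₆]; exact lt_min (lt_min (lt_min hδa hδd) (lt_min hδb hδT)) hδ₂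
  have hδ₆a : δ₆ ≤ δa := by rw [hδ₆]; exact (min_le_left _ _).trans ((min_le_left _ _).trans (min_le_left _ _))
  have hδ₆d : δ₆ ≤ δd := by rw [hδ₆]; exact (min_le_left _ _).trans ((min_le_left _ _).trans (min_le_right _ _))
  have hδ₆b : δ₆ ≤ δb := by rw [hδ₆]; exact (min_le_left _ _).trans ((min_le_right _ _).trans (min_le_left _ _))
  have hδ₆T : δ₆ ≤ δT := by rw [hδ₆]; exact (min_le_left _ _).trans ((min_le_right _ _).trans (min_le_right _ _))
  have hδ₆2 : δ₆ ≤ δ₂ := by rw [hδ₆]; exact min_le_right _ _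
  obtain ⟨A₁, hA₁⟩ : ∃ A₁ : ℝ, A₁ = (d + 1) * D1 hprof := ⟨_, rfl⟩
  have hA₁0 : 0 ≤ A₁ := by rw [hA₁]; positivity
  obtain ⟨cL, hcL⟩ : ∃ cL : ℝ, cL = 2 * c' + ((d : ℝ) + 1) * Real.exp δ₆ * cd := ⟨_, rfl⟩
  have hcL0 : 0 ≤ cL := by rw [hcL]; positivity
  obtain ⟨B₆, hB₆⟩ : ∃ B₆ : ℝ, B₆ = (A₁ * cs + cT) + A₁ * (A₁ * c' + cL) := ⟨_, rfl⟩
  have hB₆0 : 0 ≤ B₆ := by rw [hB₆]; positivity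
  refine ⟨δ₆, 2 * C₀ + 2 * 2 ^ (d + 1) * B₆ + 1, hδ₆0, by positivity, ?_⟩
  intro k hk aj m2 a e1 e2 e3 e4 e5 e6 Mh hMh P hP Λ μ x x' hne
  have hMh1 : 1 ≤ Mh := le_trans (by norm_num) hMh
  have hn1 : 1 ≤ (ℓ + 1) ^ k := Nat.one_le_pow _ _ (by omega)
  have hnr : (0 : ℝ) < (((ℓ + 1) ^ k : ℕ) : ℝ) := by exact_mod_cast hn1
  have hN1 : 1 ≤ (ℓ + 1) ^ k * ((ℓ + 1) * Mh) := Nat.one_le_iff_ne_zero.2 (by positivity)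
  have hM1 : (1 : ℝ) ≤ ((ℓ : ℝ) + 1) * Mh := by
    have : (1 : ℝ) ≤ Mh := by exact_mod_cast hMh1
    have : (0 : ℝ) ≤ ℓ := Nat.cast_nonneg ℓ
    nlinarith
  have hMpos : (0 : ℝ) < ((ℓ : ℝ) + 1) * Mh := by linarith
  have hs1 : 1 ≤ supNorm (x'.1 - x.1) := one_le_supNorm (sub_ne_zero.2 hne)
  have hs0 : 0 < supNorm (x'.1 - x.1) := lt_of_lt_of_le one_pos hs1
  set n : ℕ := (ℓ + 1) ^ k with hn
  set W : ℝ := (((n : ℕ) : ℝ) / supNorm (x'.1 - x.1)) ^ α with hW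
  have hW0 : 0 ≤ W := Real.rpow_nonneg (div_nonneg hnr.le hs0.le) α
  set D₀ := dstar n μ (B6Eq250.gZero (hDiag ℓ k Mh P) (gPad ℓ k Mh P aj a m2 Λ hP)) with hD₀
  rcases le_or_gt (((n : ℕ) : ℝ)) (supNorm (x'.1 - x.1)) with hfar | hnear
  · -- FAR: the weight is `≤ 1`, the two rows are summed separately
    have hW1 : W ≤ 1 := by
      rw [hW]; exact Real.rpow_le_one (div_nonneg hnr.le hs0.le) ((div_le_one hs0).2 hfar) hα0
    have hsplit := wsum2_split_le hδ₆0.le n x x' (fun z => W * (D₀ x' z - D₀ x z))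
      (fun z => W * (-D₀ x z)) (fun z => W * D₀ x' z) (fun z => by ring)
    have hrow : ∀ p : ↥(Box d ℓ k (fun i => (ℓ + 1) * (Mh * P i))), roww δ₆ n D₀ p ≤ C₀ := fun p =>
      (roww_mono hδ₆2 _ _ _).trans (hG0 k hk aj m2 a e1 e2 e3 e4 e5 e6 Mh hMh1 P hP Λ μ p)
    have h1 : wsum δ₆ n x (fun z => W * (-D₀ x z)) ≤ C₀ := by
      rw [wsum_mul_left _ _ _ hW0]
      have : wsum δ₆ n x (fun z => -D₀ x z) = roww δ₆ n D₀ x := by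
        unfold wsum roww; exact Finset.sum_congr rfl fun z _ => by rw [abs_neg]
      rw [this]
      exact (mul_le_of_le_one_left (roww_nonneg _ _ _ _) hW1).trans (hrow x)
    have h2 : wsum δ₆ n x' (fun z => W * D₀ x' z) ≤ C₀ := by
      rw [wsum_mul_left _ _ _ hW0]
      have : wsum δ₆ n x' (fun z => D₀ x' z) = roww δ₆ n D₀ x' := rfl
      rw [this]
      exact (mul_le_of_le_one_left (roww_nonneg _ _ _ _) hW1).trans (hrow x')
    have : wsum2 δ₆ n x x' (fun z => W * (D₀ x' z - D₀ x z)) ≤ C₀ + C₀ := hsplit.trans (add_le_add h1 h2)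
    have hB0 : 0 ≤ 2 * 2 ^ (d + 1) * B₆ + 1 := by positivity
    linarith
  · -- NEAR: cube by cube
    have hM' : ∀ q : ↥(ctrs P), ∀ i, 1 ≤ cubeM' Mh P q.1 i := fun q i =>
      Nat.one_le_iff_ne_zero.2 (Nat.mul_ne_zero_iff.2 ⟨by omega, by have := (one_le_cubeW hP q.2 i).1; omega⟩)
    -- `ξ^{−1}|h_q(fwd z) − h_q(z)| ≤ (d+1)sup|h′|`
    have hdh : ∀ (q : ↥(ctrs P)) (z : ↥(Box d ℓ k (fun i => (ℓ + 1) * (Mh * P i)))),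
        |((n : ℕ) : ℝ) * (hΩ ℓ k Mh P q.1 (fwd _ μ z) - hΩ ℓ k Mh P q.1 z)| ≤ A₁ := by
      intro q z
      have h := abs_hq_sub_le (d := d) hn1 (Nat.one_le_iff_ne_zero.2 (by positivity : (ℓ + 1) * Mh ≠ 0)) q.1 z.1
        (fwd _ μ z).1
      unfold hΩ
      rw [abs_mul, abs_of_nonneg (Nat.cast_nonneg _)]
      have hsf := supNorm_fwd_sub_le μ z
      have hM'' : (1 : ℝ) ≤ (((ℓ + 1) * Mh : ℕ) : ℝ) := by push_cast; exact hM1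
      calc ((n : ℕ) : ℝ) * |hq n ((ℓ + 1) * Mh) q.1 (fwd _ μ z).1 - hq n ((ℓ + 1) * Mh) q.1 z.1|
          ≤ ((n : ℕ) : ℝ) * ((d + 1) * D1 hprof / (((ℓ + 1) * Mh : ℕ) : ℝ) * supNorm ((fwd _ μ z).1 - z.1)
              / ((n : ℕ) : ℝ)) := mul_le_mul_of_nonneg_left h (Nat.cast_nonneg _)
        _ = (d + 1) * D1 hprof / (((ℓ + 1) * Mh : ℕ) : ℝ) * supNorm ((fwd _ μ z).1 - z.1) := by
            field_simp
        _ ≤ (d + 1) * D1 hprof / (((ℓ + 1) * Mh : ℕ) : ℝ) * 1 :=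
            mul_le_mul_of_nonneg_left hsf (div_nonneg (mul_nonneg (by positivity) hD1) (Nat.cast_nonneg _))
        _ ≤ A₁ := by
            rw [mul_one, hA₁]; exact div_le_self (mul_nonneg (by positivity) hD1) hM''
    -- per cube
    have hterm : ∀ q : ↥(ctrs P),
        wsum2 δ₆ n x x' (fun z => W * (dstar n μ (B6Eq250.aTerm (hDiag ℓ k Mh P) (gPad ℓ k Mh P aj a m2 Λ hP) q) x' z
          - dstar n μ (B6Eq250.aTerm (hDiag ℓ k Mh P) (gPad ℓ k Mh P aj a m2 Λ hP) q) x z)) ≤ B₆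
        ∧ ((hΩ ℓ k Mh P q.1 x = 0 ∧ hΩ ℓ k Mh P q.1 x' = 0) →
          wsum2 δ₆ n x x' (fun z => W * (dstar n μ (B6Eq250.aTerm (hDiag ℓ k Mh P) (gPad ℓ k Mh P aj a m2 Λ hP) q) x' z
            - dstar n μ (B6Eq250.aTerm (hDiag ℓ k Mh P) (gPad ℓ k Mh P aj a m2 Λ hP) q) x z)) = 0) := by
      intro q
      have hzero : (hΩ ℓ k Mh P q.1 x = 0 ∧ hΩ ℓ k Mh P q.1 x' = 0) →
          wsum2 δ₆ n x x' (fun z => W * (dstar n μ (B6Eq250.aTerm (hDiag ℓ k Mh P) (gPad ℓ k Mh P aj a m2 Λ hP) q) x' z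
            - dstar n μ (B6Eq250.aTerm (hDiag ℓ k Mh P) (gPad ℓ k Mh P aj a m2 Λ hP) q) x z)) = 0 := by
        rintro ⟨h0, h0'⟩
        unfold wsum2
        refine Finset.sum_eq_zero fun z _ => ?_
        simp only
        rw [dstar_aTerm_row_eq_zero n μ hP q h0, dstar_aTerm_row_eq_zero n μ hP q h0', sub_self, mul_zero, abs_zero,
          zero_mul]
      refine ⟨?_, hzero⟩
      by_cases hboth : hΩ ℓ k Mh P q.1 x = 0 ∧ hΩ ℓ k Mh P q.1 x' = 0
      · rw [hzero hboth]; exact hB₆0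
      · have hxx' : supNorm (x'.1 - x.1) ≤ 2 * (((ℓ + 1) ^ k : ℕ) : ℝ) := by rw [← hn]; linarith
        have hx'x : supNorm (x.1 - x'.1) ≤ 2 * (((ℓ + 1) ^ k : ℕ) : ℝ) := by
          rw [← neg_sub, B4TorusKernel.supNorm_neg]; exact hxx'
        obtain ⟨b, b', hb, hb'⟩ : ∃ b b' : ↥(Box d ℓ k (fun i => (ℓ + 1) * cubeM' Mh P q.1 i)),
            emb ℓ k Mh P q.1 hP q.2 b = x ∧ emb ℓ k Mh P q.1 hP q.2 b' = x' := by
          rw [not_and_or] at hboth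
          rcases hboth with h0 | h0
          · obtain ⟨b, hb⟩ := exists_emb_eq_of_near hℓ hk hMh hP q.2 h0 (p := x) (by
              rw [sub_self]; simp [B4ContourShift.supNorm]; positivity)
            obtain ⟨b', hb'⟩ := exists_emb_eq_of_near hℓ hk hMh hP q.2 h0 hxx'
            exact ⟨b, b', hb, hb'⟩
          · obtain ⟨b', hb'⟩ := exists_emb_eq_of_near hℓ hk hMh hP q.2 h0 (p := x') (by
              rw [sub_self]; simp [B4ContourShift.supNorm]; positivity)
            obtain ⟨b, hb⟩ := exists_emb_eq_of_near hℓ hk hMh hP q.2 h0 hx'x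
            exact ⟨b, b', hb, hb'⟩
        subst hb hb'
        have hbb : b'.1 - b.1 = (emb ℓ k Mh P q.1 hP q.2 b').1 - (emb ℓ k Mh P q.1 hP q.2 b).1 :=
          (emb_sub_emb hP q.2 b' b).symm
        have hneb : b'.1 ≠ b.1 := fun h => hne (by
          have := emb_sub_emb hP q.2 b' b; rw [h, sub_self] at this; exact (sub_eq_zero.1 this))
        have hnearb : supNorm (b'.1 - b.1) ≤ (((ℓ + 1) ^ k : ℕ) : ℝ) := by rw [hbb, ← hn]; exact hnear.le
        rw [hW, ← hbb, hB₆, hcL, hn]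
        have hA₁M : 0 ≤ A₁ / (((ℓ : ℝ) + 1) * Mh) := by positivity
        have hκle : A₁ / (((ℓ : ℝ) + 1) * Mh) ≤ A₁ := div_le_self hA₁0 hM1
        have hTq : wsum2 δ₆ ((ℓ + 1) ^ k) b b' (fun w => ((((ℓ + 1) ^ k : ℕ) : ℝ) / supNorm (b'.1 - b.1)) ^ α *
            ((((ℓ + 1) ^ k : ℕ) : ℝ) * ((cubeG ℓ k Mh P aj a m2 Λ hP q b' (fwd _ μ w) - cubeG ℓ k Mh P aj a m2 Λ hP q b' w)
              - (cubeG ℓ k Mh P aj a m2 Λ hP q b (fwd _ μ w) - cubeG ℓ k Mh P aj a m2 Λ hP q b w)))) ≤ cT := by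
          refine (wsum2_mono_rate hδ₆T _ _ _ _).trans ?_
          have := h243T k hk aj m2 a e1 e2 e3 e4 e5 e6 (cubeM' Mh P q.1) (hM' q) (lamLoc ℓ Mh P q.1 hP q.2 Λ) μ b b' hneb
          unfold wsum2; exact this
        have hdh' : ∀ z : ↥(Box d ℓ k (fun i => (ℓ + 1) * (Mh * P i))),
            |((((ℓ + 1) ^ k : ℕ)) : ℝ) * (hΩ ℓ k Mh P q.1 (fwd _ μ z) - hΩ ℓ k Mh P q.1 z)| ≤ A₁ := by
          intro z; have := hdh q z; rw [hn] at this; exact this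
        refine (wsum2_dstar_aTerm_pair_le hℓ hk hMh1 hP q μ hδ₆0.le hc'.le hcd.le hA₁M hA₁0
          (fun p => (roww_mono hδ₆a _ _ _).trans
            (h243 k hk aj m2 a e1 e2 e3 e4 e5 e6 (cubeM' Mh P q.1) (hM' q) (lamLoc ℓ Mh P q.1 hP q.2 Λ) p))
          (fun i v ve hve => (wsum_mono hδ₆d _ _ _).trans (by
            have := h243d k hk aj m2 a e1 e2 e3 e4 e5 e6 (cubeM' Mh P q.1) (hM' q) (lamLoc ℓ Mh P q.1 hP q.2 Λ) i v ve hve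
            unfold wsum; exact this))
          (fun p => (roww_mono hδ₆b _ _ _).trans
            (h243s k hk aj m2 a e1 e2 e3 e4 e5 e6 (cubeM' Mh P q.1) (hM' q) (lamLoc ℓ Mh P q.1 hP q.2 Λ) μ p))
          (fun z z' => by rw [hA₁]; exact hLoc_lipschitz hMh1 q.1 z z') hdh' hα0 hα1.le b b' hneb hnearb hTq).trans ?_
        -- `κ₁ = A₁/M ≤ A₁`
        have t1 : A₁ / (((ℓ : ℝ) + 1) * Mh) * cs ≤ A₁ * cs := mul_le_mul_of_nonneg_right hκle hcs.le
        have t2 : A₁ / (((ℓ : ℝ) + 1) * Mh) * c' ≤ A₁ * c' := mul_le_mul_of_nonneg_right hκle hc'.le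
        have t3 : 0 ≤ 2 * c' + ((d : ℝ) + 1) * Real.exp δ₆ * cd := by positivity
        nlinarith [t1, t2, t3, hA₁0, hcT.le]
    -- `dstar G′₀ = Σ_q dstar(h_qG′(□_q)h_q)` and the overlap count
    have hfun : (fun z => W * (D₀ x' z - D₀ x z))
        = fun z => ∑ q : ↥(ctrs P), W *
          (dstar n μ (B6Eq250.aTerm (hDiag ℓ k Mh P) (gPad ℓ k Mh P aj a m2 Λ hP) q) x' z
            - dstar n μ (B6Eq250.aTerm (hDiag ℓ k Mh P) (gPad ℓ k Mh P aj a m2 Λ hP) q) x z) := by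
      funext z
      rw [hD₀, B6Eq250.gZero_eq_sum_aTerm, dstar_sum]
      simp only [Matrix.sum_apply]
      rw [← Finset.sum_sub_distrib, Finset.mul_sum]
    rw [hfun]
    refine (wsum2_sum_le' _ _ _ x x' _).trans ?_
    have key := sum_le_card_mul''
      (fun q : ↥(ctrs P) => wsum2 δ₆ n x x' (fun z => W *
          (dstar n μ (B6Eq250.aTerm (hDiag ℓ k Mh P) (gPad ℓ k Mh P aj a m2 Λ hP) q) x' z
            - dstar n μ (B6Eq250.aTerm (hDiag ℓ k Mh P) (gPad ℓ k Mh P aj a m2 Λ hP) q) x z)))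
      (fun q => q.1) Subtype.val_injective
      (near ((ℓ + 1) ^ k * ((ℓ + 1) * Mh)) x.1 ∪ near ((ℓ + 1) ^ k * ((ℓ + 1) * Mh)) x'.1)
      (fun q hq0 => by
        have hor : hΩ ℓ k Mh P q.1 x ≠ 0 ∨ hΩ ℓ k Mh P q.1 x' ≠ 0 := by
          by_contra hh
          push Not at hh
          exact hq0 ((hterm q).2 hh)
        have hNr : (0 : ℝ) < (((ℓ + 1) ^ k * ((ℓ + 1) * Mh) : ℕ) : ℝ) := by exact_mod_cast hN1
        rcases hor with h0 | h0
        · exact Finset.mem_union_left _ (mem_near_of_abs_lt hN1 fun ν =>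
            (abs_lt_of_hq_ne_zero hN1 h0 ν).trans (by nlinarith))
        · exact Finset.mem_union_right _ (mem_near_of_abs_lt hN1 fun ν =>
            (abs_lt_of_hq_ne_zero hN1 h0 ν).trans (by nlinarith)))
      hB₆0 (fun q => (hterm q).1)
    refine key.trans ?_
    have hcard : (((near ((ℓ + 1) ^ k * ((ℓ + 1) * Mh)) x.1 ∪ near ((ℓ + 1) ^ k * ((ℓ + 1) * Mh)) x'.1).card : ℕ) : ℝ)
        ≤ 2 * 2 ^ (d + 1) := by
      have h1 := Finset.card_union_le (near ((ℓ + 1) ^ k * ((ℓ + 1) * Mh)) x.1)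
        (near ((ℓ + 1) ^ k * ((ℓ + 1) * Mh)) x'.1)
      have h2 := card_near_le ((ℓ + 1) ^ k * ((ℓ + 1) * Mh)) x.1
      have h3 := card_near_le ((ℓ + 1) ^ k * ((ℓ + 1) * Mh)) x'.1
      have : (near ((ℓ + 1) ^ k * ((ℓ + 1) * Mh)) x.1 ∪ near ((ℓ + 1) ^ k * ((ℓ + 1) * Mh)) x'.1).card
          ≤ 2 * 2 ^ (d + 1) := by omega
      exact_mod_cast this
    calc (((near ((ℓ + 1) ^ k * ((ℓ + 1) * Mh)) x.1 ∪ near ((ℓ + 1) ^ k * ((ℓ + 1) * Mh)) x'.1).card : ℕ) : ℝ) * B₆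
        ≤ (2 * 2 ^ (d + 1)) * B₆ := mul_le_mul_of_nonneg_right hcard hB₆0
      _ ≤ 2 * C₀ + 2 * 2 ^ (d + 1) * B₆ + 1 := by nlinarith [hC₀.le]

end GZeroPairAssembly

/-! ## §5 (2.66) ⇒ (2.67)₅: the Hölder quotient of the kernel of `G′∇*`, `G′ = (Δ_Ω^{L^{−j},N} + m² + Q′*aQ′)^{−1}` -/

section Entry5

variable {ℓ k Mh : ℕ} {P : Fin (d + 1) → ℕ}

open Literature.MathematicalPhysics.QuantumFieldTheory.Balaban1983to89.B6Eq238TwoLevelBox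
open Literature.MathematicalPhysics.QuantumFieldTheory.Balaban1983to89.B6Partition236TwoLevelBox (ctrs)
open Literature.MathematicalPhysics.QuantumFieldTheory.Balaban1983to89.B6Ineq243AdjTwoLevelBox (dstar_add dstar_mul)
open Literature.MathematicalPhysics.QuantumFieldTheory.Balaban1983to89.B6Prop22AdjTwoLevelBox (prop22_entry3_twoLevelBox
  gTwoLevel_eq_gZero_add_transpose)
open Literature.MathematicalPhysics.QuantumFieldTheory.Balaban1983to89.B6Ineq243HolderTwoLevelBox (wsum2_vecMul_le)
open Literature.MathematicalPhysics.QuantumFieldTheory.Balaban1983to89.B4Thm19ZeroBoxHolder (abs_sum_mul_le_of_wsum2)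

variable {N : Fin (d + 1) → ℕ} in
/-- two rows of `A + R·D` with a weight: `W((A + RD)(x′,z) − (A + RD)(x,z)) = W(A(x′,z) − A(x,z)) +
Σ_y (W(R(x′,y) − R(x,y)))D(y,z)`. [folklore] -/
private theorem rows_add_mul (A R D : Matrix ↥(boxDom N) ↥(boxDom N) ℝ) (W : ℝ) (x' x z : ↥(boxDom N)) :
    W * ((A + R * D) x' z - (A + R * D) x z)
      = W * (A x' z - A x z) + ∑ y, (W * (R x' y - R x y)) * D y z := by
  simp only [Matrix.add_apply, Matrix.mul_apply]
  have : ∑ y, (W * (R x' y - R x y)) * D y z = W * (∑ y, R x' y * D y z - ∑ y, R x y * D y z) := by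
    rw [← Finset.sum_sub_distrib, Finset.mul_sum]
    exact Finset.sum_congr rfl fun y _ => by ring
  rw [this]
  ring

/-- **[B6] PROPOSITION 2.2 (2.67), FIFTH ENTRY `‖ζG′∇*λ‖_α`, FOR THE GENUINE TWO-LEVEL OPERATOR ON A BOX — two-centre
weighted-row form of the Hölder quotient in `x` of the kernel of `G′∇*`.**  For every dimension, block size, windows and
`0 ≤ α < 1` there are `δ, M₀, C > 0` such that for EVERY mesh `k ≥ 1` (`n = L^k`), window point, `M_h ≥ 3` with
`L·M_h ≥ M₀`, volume `P`, block union `Λ`, axis `μ` and all `x ≠ x′` of `Ω`: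
`Σ_z (n/|x′−x|_∞)^α·|ξ^{−1}(G′(x′,fwd_μz) − G′(x′,z)) − ξ^{−1}(G′(x,fwd_μz) − G′(x,z))|·e^{δmin(|x−z|,|x′−z|)/n} ≤ C`,
`G′ = gTwoLevel` (the genuine `(Δ_Ω^{ξ,N} + m² + Q′*aQ′)^{−1}`).  ROUTE («(2.66) ⇒ (2.67)» in the transposed ordering):
`dstar G′ = dstar G′₀ + Rᵀ·dstar G′` (`gTwoLevel_eq_gZero_add_transpose`, `dstar_mul`), two rows of `Rᵀ·D` are the
two-row vector of `Rᵀ` against `D` (`wsum2_vecMul_le`); the (2.64)-input §4, the column smallness §3 (`≤ C_Ψ/(LM_h) ≤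
C_Ψ`) and the rows of `dstar G′` (`prop22_entry3_twoLevelBox`).  HONEST LABEL: the [3]-input is the column companion of
(1.9) (`B4Thm19ZeroBoxHolderDual`, not printed in [3]; HOME/GAPS.md G-B6-21).
[cite: Balaban1984PropagatorsII, Proposition 2.2 (2.67) p.234 (fifth entry), «a Hölder norm of a derivative» p.234, (2.64)–(2.66) p.234, (2.50) p.232] -/
theorem prop22_entry5_twoLevelBox (d ℓ : ℕ) (hℓ : 1 ≤ ℓ) (aminus aplus m2plus a2minus a2plus : ℝ) (ha : 0 < aminus)
    (ha2 : 0 < a2minus) (α : ℝ) (hα0 : 0 ≤ α) (hα1 : α < 1) :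
    ∃ δ M₀ C : ℝ, 0 < δ ∧ 0 < M₀ ∧ 0 < C ∧ ∀ (k : ℕ), 1 ≤ k → ∀ (aj m2 a : ℝ), aminus ≤ aj → aj ≤ aplus → 0 ≤ m2 →
      m2 ≤ m2plus → a2minus ≤ a → a ≤ a2plus → ∀ (Mh : ℕ), 3 ≤ Mh → M₀ ≤ ((ℓ : ℝ) + 1) * Mh →
        ∀ (P : Fin (d + 1) → ℕ), (∀ i, 1 ≤ P i) → ∀ (Λ : Finset ↥(boxDom (fun i => (ℓ + 1) * (Mh * P i)))),
        IsBlockUnion ℓ (fun i => Mh * P i) Λ → ∀ (μ : Fin (d + 1))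
        (x x' : ↥(Box d ℓ k (fun i => (ℓ + 1) * (Mh * P i)))), x'.1 ≠ x.1 →
          wsum2 δ ((ℓ + 1) ^ k) x x' (fun z => ((((ℓ + 1) ^ k : ℕ) : ℝ) / supNorm (x'.1 - x.1)) ^ α *
            (dstar ((ℓ + 1) ^ k) μ (gTwoLevel ((ℓ + 1) ^ k) ℓ aj a m2 (fun i => Mh * P i) Λ) x' z
              - dstar ((ℓ + 1) ^ k) μ (gTwoLevel ((ℓ + 1) ^ k) ℓ aj a m2 (fun i => Mh * P i) Λ) x z)) ≤ C := by
  obtain ⟨δ₆, C₆, hδ₆, hC₆, h6⟩ := wsum2_dstar_gZero_pair_le d ℓ hℓ aminus aplus m2plus a2minus a2plus ha ha2 α hα0 hα1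
  obtain ⟨δ₅, CΨ, hδ₅, hCΨ, h5⟩ := wsum2_transpose_rOp_pair_le d ℓ hℓ aminus aplus m2plus a2minus a2plus ha ha2 α hα0 hα1
  obtain ⟨δ₃, M₃, C₃, hδ₃, hM₃, hC₃, h3⟩ := prop22_entry3_twoLevelBox d ℓ hℓ aminus aplus m2plus a2minus a2plus ha ha2
  refine ⟨min δ₆ (min δ₅ δ₃), M₃, C₆ + CΨ * C₃, lt_min hδ₆ (lt_min hδ₅ hδ₃), hM₃, by positivity, ?_⟩
  intro k hk aj m2 a e1 e2 e3 e4 e5 e6 Mh hMh hM P hP Λ hΛ μ x x' hne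
  have hMh1 : 1 ≤ Mh := le_trans (by norm_num) hMh
  have hδ0 : 0 ≤ min δ₆ (min δ₅ δ₃) := (lt_min hδ₆ (lt_min hδ₅ hδ₃)).le
  have hd6 : min δ₆ (min δ₅ δ₃) ≤ δ₆ := min_le_left _ _
  have hd5 : min δ₆ (min δ₅ δ₃) ≤ δ₅ := (min_le_right _ _).trans (min_le_left _ _)
  have hd3 : min δ₆ (min δ₅ δ₃) ≤ δ₃ := (min_le_right _ _).trans (min_le_right _ _)
  have hM1 : (1 : ℝ) ≤ ((ℓ : ℝ) + 1) * Mh := by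
    have : (1 : ℝ) ≤ Mh := by exact_mod_cast hMh1
    have : (0 : ℝ) ≤ ℓ := Nat.cast_nonneg ℓ
    nlinarith
  have hMpos : (0 : ℝ) < ((ℓ : ℝ) + 1) * Mh := by linarith
  set G := gTwoLevel ((ℓ + 1) ^ k) ℓ aj a m2 (fun i => Mh * P i) Λ with hG
  set G₀ := B6Eq250.gZero (hDiag ℓ k Mh P) (gPad ℓ k Mh P aj a m2 Λ hP) with hG₀
  set Rt := (B6Eq250.rOp (twoLevelOp ((ℓ + 1) ^ k) ℓ aj a m2 (fun i => Mh * P i) Λ) (hDiag ℓ k Mh P)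
    (gPad ℓ k Mh P aj a m2 Λ hP))ᵀ with hRt
  set W : ℝ := ((((ℓ + 1) ^ k : ℕ) : ℝ) / supNorm (x'.1 - x.1)) ^ α with hW
  -- the transposed fixed point for `D = dstar G′`
  have hfix : dstar ((ℓ + 1) ^ k) μ G = dstar ((ℓ + 1) ^ k) μ G₀ + Rt * dstar ((ℓ + 1) ^ k) μ G := by
    have h : G = G₀ + Rt * G :=
      gTwoLevel_eq_gZero_add_transpose hℓ hk hMh1 hP (lt_of_lt_of_le ha e1) (lt_of_lt_of_le ha2 e5) e3 hΛ
    conv_lhs => rw [h]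
    rw [dstar_add, dstar_mul]
  have hfun : (fun z => W * (dstar ((ℓ + 1) ^ k) μ G x' z - dstar ((ℓ + 1) ^ k) μ G x z))
      = fun z => W * (dstar ((ℓ + 1) ^ k) μ G₀ x' z - dstar ((ℓ + 1) ^ k) μ G₀ x z)
          + ∑ y, (W * (Rt x' y - Rt x y)) * dstar ((ℓ + 1) ^ k) μ G y z := by
    funext z
    conv_lhs => rw [hfix]
    exact rows_add_mul _ _ _ W x' x z
  rw [hfun]
  have hA := (wsum2_mono_rate hd6 ((ℓ + 1) ^ k) x x' _).trans
    (h6 k hk aj m2 a e1 e2 e3 e4 e5 e6 Mh hMh P hP Λ μ x x' hne)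
  have hDrow : ∀ y, roww (min δ₆ (min δ₅ δ₃)) ((ℓ + 1) ^ k) (dstar ((ℓ + 1) ^ k) μ G) y ≤ C₃ := fun y =>
    (roww_mono hd3 _ _ _).trans (h3 k hk aj m2 a e1 e2 e3 e4 e5 e6 Mh hMh hM P hP Λ hΛ μ y)
  have hΨ := (wsum2_mono_rate hd5 ((ℓ + 1) ^ k) x x' _).trans
    (h5 k hk aj m2 a e1 e2 e3 e4 e5 e6 Mh hMh P hP Λ hΛ x x' hne)
  have hB : wsum2 (min δ₆ (min δ₅ δ₃)) ((ℓ + 1) ^ k) x x'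
      (fun z => ∑ y, (W * (Rt x' y - Rt x y)) * dstar ((ℓ + 1) ^ k) μ G y z) ≤ CΨ * C₃ := by
    refine (wsum2_vecMul_le hδ0 ((ℓ + 1) ^ k) x x' _ _ hDrow).trans ?_
    exact mul_le_mul_of_nonneg_right (hΨ.trans (div_le_self hCΨ.le hM1)) hC₃.le
  exact (wsum2_add_le _ _ _ _ _ _).trans (add_le_add hA hB)

/-- **THE PRINTED FORM OF THE FIFTH ENTRY**: for every `f` with `|f| ≤ F` vanishing within `min(|x−z|,|x′−z|) < D` of the
pair, `(ξ|x′−x|)^{−α}|Σ_z((G′∂^{ξ*}_μ)(x′,z) − (G′∂^{ξ*}_μ)(x,z))f(z)| ≤ Ce^{−δξD}F` — the Hölder quotient in the first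
variable of `G′∇*λ` against the cube-free geometry (`ζ ≡ 1`), uniformly in the mesh for `L·M_h ≥ M₀`.
[cite: Balaban1984PropagatorsII, Proposition 2.2 (2.67) p.234 (fifth entry)] -/
theorem gTwoLevel_dstar_holder_value_decay (d ℓ : ℕ) (hℓ : 1 ≤ ℓ) (aminus aplus m2plus a2minus a2plus : ℝ)
    (ha : 0 < aminus) (ha2 : 0 < a2minus) (α : ℝ) (hα0 : 0 ≤ α) (hα1 : α < 1) :
    ∃ δ M₀ C : ℝ, 0 < δ ∧ 0 < M₀ ∧ 0 < C ∧ ∀ (k : ℕ), 1 ≤ k → ∀ (aj m2 a : ℝ), aminus ≤ aj → aj ≤ aplus → 0 ≤ m2 →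
      m2 ≤ m2plus → a2minus ≤ a → a ≤ a2plus → ∀ (Mh : ℕ), 3 ≤ Mh → M₀ ≤ ((ℓ : ℝ) + 1) * Mh →
        ∀ (P : Fin (d + 1) → ℕ), (∀ i, 1 ≤ P i) → ∀ (Λ : Finset ↥(boxDom (fun i => (ℓ + 1) * (Mh * P i)))),
        IsBlockUnion ℓ (fun i => Mh * P i) Λ →
        ∀ (f : ↥(Box d ℓ k (fun i => (ℓ + 1) * (Mh * P i))) → ℝ) (F D : ℝ), (∀ z, |f z| ≤ F) →
        ∀ (μ : Fin (d + 1)) (x x' : ↥(Box d ℓ k (fun i => (ℓ + 1) * (Mh * P i)))), x'.1 ≠ x.1 →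
          (∀ z, f z ≠ 0 → D ≤ min (supNorm (x.1 - z.1)) (supNorm (x'.1 - z.1))) →
          |∑ z, (((((ℓ + 1) ^ k : ℕ) : ℝ) / supNorm (x'.1 - x.1)) ^ α *
            (dstar ((ℓ + 1) ^ k) μ (gTwoLevel ((ℓ + 1) ^ k) ℓ aj a m2 (fun i => Mh * P i) Λ) x' z
              - dstar ((ℓ + 1) ^ k) μ (gTwoLevel ((ℓ + 1) ^ k) ℓ aj a m2 (fun i => Mh * P i) Λ) x z)) * f z|
            ≤ C * Real.exp (-((min δ δ) * D / (((ℓ + 1) ^ k : ℕ) : ℝ))) * F := by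
  obtain ⟨δ, M₀, C, hδ, hM₀, hC, h⟩ :=
    prop22_entry5_twoLevelBox d ℓ hℓ aminus aplus m2plus a2minus a2plus ha ha2 α hα0 hα1
  refine ⟨δ, M₀, C, hδ, hM₀, hC, ?_⟩
  intro k hk aj m2 a e1 e2 e3 e4 e5 e6 Mh hMh hM P hP Λ hΛ f F D hF μ x x' hne hD
  rw [min_self]
  exact abs_sum_mul_le_of_wsum2 hδ.le _ x x' _ (h k hk aj m2 a e1 e2 e3 e4 e5 e6 Mh hMh hM P hP Λ hΛ μ x x' hne) f hF hD

end Entry5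

/-! ## §6 Non-vacuity -/

/-- the quantifier prefix of the fifth entry is inhabited: `d + 1 = 4`, `L = 2`, unit windows, `α = 1/2`.
[cite: Balaban1984PropagatorsII, Proposition 2.2 (2.67) p.234] -/
example : ∃ δ M₀ C : ℝ, 0 < δ ∧ 0 < M₀ ∧ 0 < C :=
  let ⟨δ, M₀, C, hδ, hM₀, hC, _⟩ :=
    prop22_entry5_twoLevelBox 3 1 le_rfl 1 1 1 1 1 one_pos one_pos (1 / 2) (by norm_num) (by norm_num)
  ⟨δ, M₀, C, hδ, hM₀, hC⟩

end

end Literature.MathematicalPhysics.QuantumFieldTheory.Balaban1983to89.B6Prop22DualHolderTwoLevelBox
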